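import Literature.Barriers.RiemannHypothesis.TuranPartialSumsMontgomeryEuler
import Literature.Barriers.RiemannHypothesis.TuranPartialSumsMontgomeryLineTools
import Mathlib.NumberTheory.Harmonic.Bounds
import HarnessLib

/-!
# Montgomery 1983, §4 — the integral along `Re(s+w) = 1 + 1/log x`, piece by piece

Companion of `Literature/Barriers/RiemannHypothesis/TuranPartialSums.lean` (named fact
`Literature.Barriers.RiemannHypothesis.Montgomery1983_theorem`, Montgomery 1983, Theorem p. 497), building on
`TuranPartialSumsMontgomeryEuler.lean` (`f = exp Φ`, Lemma 4) and `TuranPartialSumsMontgomeryLineTools.lean`.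

§4 of the source evaluates `Σ_{n ≤ N} a(n) n^{-s} = (1/2πi) ∫ f(s+w) x^w dw/w` ((20), `x = N + 1/2`) by
moving the contour a little to the left of `Re(s+w) = 1`. The present formalisation takes the integral on the
line `Re(s+w) = 1 + 1/Λ` (`Λ = log x`) instead — which needs `f` only on `σ > 1` — and splits it at the
half-integers into unit pieces centred at the heights `k ∈ ℤ` of the singularities `1 + ik` of `f`
(`perron_integral_eq_sum_pieces`, (20)–(21)): on the `k`-th piece `f(z) = (1/Λ + iv)^{-b̂(k)} g_k(z)` with
`g_k` controlled by Lemma 4, and the oscillating factor is `x^{iv} = e^{iΛv}`.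

* `pieceFun`, `norm_piece_sub_window_le`, `norm_piece_le` — one integration by parts outside a window about
  `v = 0` bounds the `k`-th piece (`k ≠ 0`) by `≪ M_k (L_k + Λ^{max(b̂(k),0)})/(Λ|k|)` ((21)–(22));
  `sum_norm_pieces_le` adds these up over `k ∉ {0, 1}` (`|b̂(k)| ≤ 1/3` there).
* `gOne`, `norm_windowOne_sub_main_le` — on the window about `k = 1` the factor `g₁` is almost constant and
  the piece produces the main term `g₁ · ∫ (1/Λ + iv)^{-β} e^{iΛv} dv = g₁ Λ^{β−1} e^{-1} J(√Λ)` with the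
  truncated Hankel integral `J` of `TuranPartialSumsMontgomeryHankel.lean` ((23)–(24)).
* `norm_pieceZero_le` — the piece `k = 0`, where `f` vanishes like `|v|^{β₀}` and the kernel has the nearby
  pole `1/(α + i(v − t))`, is small compared with `f(s)` itself.

## References

* [Montgomery1983] H. L. Montgomery, *Zeros of approximations to the zeta function*, Studies in Pure
  Mathematics (Turán memorial), Birkhäuser 1983, 497–506: §4, (20)–(24).
-/

noncomputable section

open Complex Set Filter Topology MeasureTheory intervalIntegral
open scoped Interval

namespace Literature.Barriers.RiemannHypothesis


section Line

variable (m : ℕ)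

/-- The point of the line `Re z = 1 + 1/Λ` at height `y`. [cite: Montgomery1983, §2 (4)–(5)] -/
def zline (Λ y : ℝ) : ℂ := ((1 + 1 / Λ : ℝ) : ℂ) + y * I

/-- `Re zline = 1 + 1/Λ`, `Im zline = y`. [folklore] -/
theorem zline_re (Λ y : ℝ) : (zline Λ y).re = 1 + 1 / Λ := by simp [zline]

/-- `Im zline = y`. [folklore] -/
theorem zline_im (Λ y : ℝ) : (zline Λ y).im = y := by simp [zline]

/-- `zline Λ (k + v) − 1 − ik = 1/Λ + iv`. [folklore] -/
theorem zline_sub (Λ : ℝ) (k : ℤ) (v : ℝ) :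
    zline Λ (k + v) - 1 - k * I = ((1 / Λ : ℝ) : ℂ) + v * I := by
  simp only [zline]; push_cast; ring

/-- **`|f|` on the line near the mode `k`** (from (18)): with `w = 1/Λ + iv`, `|v| ≤ 1/2`, `Λ ≥ 2`,
`‖w‖^{-b̂(k)} e^{-G} ≤ |f(zline(k+v))| ≤ ‖w‖^{-b̂(k)} e^{G}` where `G = A₁ + A₂ log log(|k|+5)`.
[cite: Montgomery1983, Lemma 4 (18)] -/
theorem norm_montgomeryF_line_le {A₁ A₂ : ℝ}
    (h18 : ∀ (k : ℤ) (z : ℂ), 1 < z.re → z.re ≤ 2 → |z.im - k| ≤ 1 / 2 →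
      ‖montgomeryPhi m z + (montgomeryCoeff m k : ℂ) * log (z - 1 - k * I)‖ ≤
        A₁ + A₂ * Real.log (Real.log (|(k : ℝ)| + 5)))
    {Λ : ℝ} (hΛ : 2 ≤ Λ) (k : ℤ) {v : ℝ} (hv : |v| ≤ 1 / 2) :
    ‖montgomeryF m (zline Λ (k + v))‖ ≤
      ‖((1 / Λ : ℝ) : ℂ) + v * I‖ ^ (-montgomeryCoeff m k) * Real.exp (A₁ + A₂ * Real.log (Real.log (|(k : ℝ)| + 5))) ∧
    ‖((1 / Λ : ℝ) : ℂ) + v * I‖ ^ (-montgomeryCoeff m k) * Real.exp (-(A₁ + A₂ * Real.log (Real.log (|(k : ℝ)| + 5)))) ≤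
      ‖montgomeryF m (zline Λ (k + v))‖ := by
  have hΛ0 : 0 < Λ := by linarith
  set z := zline Λ (k + v) with hz
  have hre1 : 1 < z.re := by rw [hz, zline_re]; have := one_div_pos.2 hΛ0; linarith
  have hre2 : z.re ≤ 2 := by
    rw [hz, zline_re]; have : 1 / Λ ≤ 1 / 2 := one_div_le_one_div_of_le (by norm_num) hΛ; linarith
  have him : |z.im - k| ≤ 1 / 2 := by rw [hz, zline_im]; simpa using hv
  have hG := h18 k z hre1 hre2 him
  set w : ℂ := ((1 / Λ : ℝ) : ℂ) + v * I with hw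
  have hw0 : w ≠ 0 := inv_add_mul_I_ne_zero hΛ0 v
  have hzw : z - 1 - k * I = w := by rw [hz, hw]; exact zline_sub Λ k v
  rw [hzw] at hG
  set G : ℂ := montgomeryPhi m z + (montgomeryCoeff m k : ℂ) * log w with hGdef
  have hnorm : ‖montgomeryF m z‖ = ‖w‖ ^ (-montgomeryCoeff m k) * Real.exp G.re := by
    rw [norm_montgomeryF_eq m hre1, show montgomeryPhi m z = G - (montgomeryCoeff m k : ℂ) * log w by
      rw [hGdef]; ring, sub_re, Real.exp_sub, re_ofReal_mul, log_re,
      Real.rpow_def_of_pos (norm_pos_iff.2 hw0)]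
    rw [div_eq_mul_inv, ← Real.exp_neg, mul_comm]
    congr 1; ring
  have hGre : |G.re| ≤ A₁ + A₂ * Real.log (Real.log (|(k : ℝ)| + 5)) := (abs_re_le_norm G).trans hG
  have hpos : 0 ≤ ‖w‖ ^ (-montgomeryCoeff m k) := Real.rpow_nonneg (norm_nonneg _) _
  rw [hnorm]
  constructor
  · exact mul_le_mul_of_nonneg_left (Real.exp_le_exp.2 (abs_le.1 hGre).2) hpos
  · exact mul_le_mul_of_nonneg_left (Real.exp_le_exp.2 (abs_le.1 hGre).1) hpos

/-- **`|f'/f|` on the line near the mode `k`** (from (19)): `‖f'(z)‖ ≤ ‖f(z)‖ (|b̂(k)|/‖w‖ + L)` with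
`L = A₃ + A₄ log(|k|+5)`, `z = zline(k+v)`, `|v| ≤ 1/2`, `Λ ≥ 2` (`Re z < 2`). [cite: Montgomery1983, Lemma 4 (19)] -/
theorem norm_deriv_montgomeryF_line_le {A₃ A₄ : ℝ}
    (h19 : ∀ (k : ℤ) (z : ℂ), 1 < z.re → z.re ≤ 2 → |z.im - k| ≤ 1 / 2 →
      ‖montgomeryPhiDeriv m z + (montgomeryCoeff m k : ℂ) / (z - 1 - k * I)‖ ≤ A₃ + A₄ * Real.log (|(k : ℝ)| + 5))
    {Λ : ℝ} (hΛ : 2 ≤ Λ) (k : ℤ) {v : ℝ} (hv : |v| ≤ 1 / 2) :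
    ‖deriv (montgomeryF m) (zline Λ (k + v))‖ ≤ ‖montgomeryF m (zline Λ (k + v))‖ *
      (|montgomeryCoeff m k| / ‖((1 / Λ : ℝ) : ℂ) + v * I‖ + (A₃ + A₄ * Real.log (|(k : ℝ)| + 5))) := by
  have hΛ0 : 0 < Λ := by linarith
  set z := zline Λ (k + v) with hz
  have hre1 : 1 < z.re := by rw [hz, zline_re]; have := one_div_pos.2 hΛ0; linarith
  have hre2 : z.re < 2 := by
    rw [hz, zline_re]; have : 1 / Λ ≤ 1 / 2 := one_div_le_one_div_of_le (by norm_num) hΛ; linarith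
  have him : |z.im - k| ≤ 1 / 2 := by rw [hz, zline_im]; simpa using hv
  have hG := h19 k z hre1 hre2.le him
  set w : ℂ := ((1 / Λ : ℝ) : ℂ) + v * I with hw
  have hw0 : w ≠ 0 := inv_add_mul_I_ne_zero hΛ0 v
  have hzw : z - 1 - k * I = w := by rw [hz, hw]; exact zline_sub Λ k v
  rw [hzw] at hG
  rw [deriv_montgomeryF m hre1 hre2, norm_mul, mul_comm]
  refine mul_le_mul_of_nonneg_left ?_ (norm_nonneg _)
  calc ‖montgomeryPhiDeriv m z‖
      = ‖(montgomeryPhiDeriv m z + (montgomeryCoeff m k : ℂ) / w) - (montgomeryCoeff m k : ℂ) / w‖ := by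
        rw [add_sub_cancel_right]
    _ ≤ ‖montgomeryPhiDeriv m z + (montgomeryCoeff m k : ℂ) / w‖ + ‖(montgomeryCoeff m k : ℂ) / w‖ := norm_sub_le _ _
    _ ≤ (A₃ + A₄ * Real.log (|(k : ℝ)| + 5)) + |montgomeryCoeff m k| / ‖w‖ := by
        refine add_le_add hG (le_of_eq ?_)
        rw [norm_div, norm_real, Real.norm_eq_abs]
    _ = _ := add_comm _ _

/-! ## The piece integrand `h_k(v) = f(zline(k+v)) · c / (α + i(k+v−t))` -/

/-- The non-oscillating factor of the `k`-th piece of the line integral: `h_k(v) = f(z) c/(α + i(k+v−t))`,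
`z = zline(k+v)` (`c` stands for the unimodular constant `x^{i(k−t)}`). [cite: Montgomery1983, §4 (20)] -/
def pieceFun (Λ α t : ℝ) (c : ℂ) (k : ℤ) (v : ℝ) : ℂ :=
  montgomeryF m (zline Λ (k + v)) * c / ((α : ℂ) + (((k : ℝ) + v - t : ℝ) : ℂ) * I)

/-- The denominator `α + i(k+v−t)` is at least `|k|/4` in modulus (`k ≠ 0`, `|t| ≤ 1/4`, `|v| ≤ 1/2`).
[folklore] -/
theorem norm_pieceDen_ge {α t v : ℝ} {k : ℤ} (hk : k ≠ 0) (ht : |t| ≤ 1 / 4) (hv : |v| ≤ 1 / 2) :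
    |(k : ℝ)| / 4 ≤ ‖(α : ℂ) + (((k : ℝ) + v - t : ℝ) : ℂ) * I‖ := by
  have hk1 : 1 ≤ |(k : ℝ)| := by exact_mod_cast Int.one_le_abs hk
  calc |(k : ℝ)| / 4 ≤ |(k : ℝ) + v - t| := by
        have h1 : |(k : ℝ)| - |v| - |t| ≤ |(k : ℝ) + v - t| := by
          have := abs_add_le ((k : ℝ) + v - t) (t - v)
          have h2 : |t - v| ≤ |t| + |v| := by simpa [sub_eq_add_neg, abs_neg] using abs_add_le t (-v)
          have h3 : (k : ℝ) + v - t + (t - v) = k := by ring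
          rw [h3] at this
          linarith
        linarith
    _ = |((α : ℂ) + (((k : ℝ) + v - t : ℝ) : ℂ) * I).im| := by simp
    _ ≤ _ := abs_im_le_norm _

/-- The denominator does not vanish (`k ≠ 0`, `|t| ≤ 1/4`, `|v| ≤ 1/2`). [folklore] -/
theorem pieceDen_ne_zero {α t v : ℝ} {k : ℤ} (hk : k ≠ 0) (ht : |t| ≤ 1 / 4) (hv : |v| ≤ 1 / 2) :
    (α : ℂ) + (((k : ℝ) + v - t : ℝ) : ℂ) * I ≠ 0 := by
  intro h
  have := norm_pieceDen_ge (α := α) hk ht hv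
  rw [h, norm_zero] at this
  have hk1 : (1 : ℝ) ≤ |(k : ℝ)| := by exact_mod_cast Int.one_le_abs hk
  linarith

/-- Derivative of `v ↦ f(zline Λ (k+v))`: `i f'(z)` (`Λ ≥ 2`, `|v| < 1` keeps `Re z ∈ (1,2)`). [folklore] -/
theorem hasDerivAt_montgomeryF_zline {Λ : ℝ} (hΛ : 2 ≤ Λ) (k : ℤ) (v : ℝ) :
    HasDerivAt (fun v : ℝ ↦ montgomeryF m (zline Λ (k + v)))
      (deriv (montgomeryF m) (zline Λ (k + v)) * I) v := by
  have hΛ0 : 0 < Λ := by linarith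
  have hre1 : 1 < (zline Λ (k + v)).re := by rw [zline_re]; have := one_div_pos.2 hΛ0; linarith
  have hre2 : (zline Λ (k + v)).re < 2 := by
    rw [zline_re]; have : 1 / Λ ≤ 1 / 2 := one_div_le_one_div_of_le (by norm_num) hΛ; linarith
  set g : ℂ → ℂ := fun u ↦ ((1 + 1 / Λ : ℝ) : ℂ) + ((k : ℂ) + u) * I with hg
  have hgd : HasDerivAt g I (v : ℂ) := by
    have := ((hasDerivAt_id (v : ℂ)).const_add (k : ℂ)).mul_const I |>.const_add (((1 + 1 / Λ : ℝ) : ℂ))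
    simpa [hg] using this
  have hgv : g v = zline Λ (k + v) := by simp only [hg, zline]; push_cast; ring
  have hd : DifferentiableAt ℂ (montgomeryF m) (g v) := by
    rw [hgv]; exact differentiableAt_montgomeryF m hre1 hre2
  have h2 := hd.hasDerivAt.comp (v : ℂ) hgd
  rw [hgv] at h2
  have h3 := h2.comp_ofReal
  refine h3.congr_of_eventuallyEq (Eventually.of_forall fun u ↦ ?_)
  simp only [Function.comp, hg, zline]
  push_cast
  ring_nf

/-- **The derivative of the piece integrand**: `h_k'(v) = i c (f'(z)/d − f(z)/d²)`, `d = α + i(k+v−t)`.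
[folklore] -/
theorem hasDerivAt_pieceFun {Λ : ℝ} (hΛ : 2 ≤ Λ) {α t : ℝ} (c : ℂ) {k : ℤ} (hk : k ≠ 0)
    (ht : |t| ≤ 1 / 4) {v : ℝ} (hv : |v| ≤ 1 / 2) :
    HasDerivAt (pieceFun m Λ α t c k)
      (I * c * (deriv (montgomeryF m) (zline Λ (k + v)) / ((α : ℂ) + (((k : ℝ) + v - t : ℝ) : ℂ) * I) -
        montgomeryF m (zline Λ (k + v)) / ((α : ℂ) + (((k : ℝ) + v - t : ℝ) : ℂ) * I) ^ 2)) v := by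
  have hd0 := pieceDen_ne_zero (α := α) hk ht hv
  -- the denominator as a function of `v`
  have hden : HasDerivAt (fun v : ℝ ↦ (α : ℂ) + (((k : ℝ) + v - t : ℝ) : ℂ) * I) I v := by
    have h1 : HasDerivAt (fun u : ℂ ↦ (α : ℂ) + ((k : ℂ) + u - t) * I) I (v : ℂ) := by
      have := (((hasDerivAt_id (v : ℂ)).const_add (k : ℂ)).sub_const (t : ℂ)).mul_const I |>.const_add (α : ℂ)
      simpa using this
    have h2 := h1.comp_ofReal
    refine h2.congr_of_eventuallyEq (Eventually.of_forall fun u ↦ ?_)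
    push_cast
    ring_nf
  have hnum : HasDerivAt (fun v : ℝ ↦ montgomeryF m (zline Λ (k + v)) * c)
      (deriv (montgomeryF m) (zline Λ (k + v)) * I * c) v :=
    (hasDerivAt_montgomeryF_zline m hΛ k v).mul_const c
  have h := hnum.div hden hd0
  unfold pieceFun
  refine h.congr_deriv ?_
  field_simp

/-- `deriv f` is continuous on the open strip `1 < Re z < 2`. [folklore] -/
theorem continuousAt_deriv_montgomeryF {z : ℂ} (h1 : 1 < z.re) (h2 : z.re < 2) :
    ContinuousAt (deriv (montgomeryF m)) z := by
  have hU : IsOpen {z : ℂ | 1 < z.re ∧ z.re < 2} :=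
    (isOpen_lt continuous_const continuous_re).inter (isOpen_lt continuous_re continuous_const)
  have hd : DifferentiableOn ℂ (montgomeryF m) {z : ℂ | 1 < z.re ∧ z.re < 2} :=
    fun w hw ↦ (differentiableAt_montgomeryF m hw.1 hw.2).differentiableWithinAt
  exact ((hd.analyticOnNhd hU) z ⟨h1, h2⟩).deriv.continuousAt

section PieceBounds

variable {A₁ A₂ A₃ A₄ : ℝ}
  (h18 : ∀ (k : ℤ) (z : ℂ), 1 < z.re → z.re ≤ 2 → |z.im - k| ≤ 1 / 2 →
    ‖montgomeryPhi m z + (montgomeryCoeff m k : ℂ) * log (z - 1 - k * I)‖ ≤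
      A₁ + A₂ * Real.log (Real.log (|(k : ℝ)| + 5)))
  (h19 : ∀ (k : ℤ) (z : ℂ), 1 < z.re → z.re ≤ 2 → |z.im - k| ≤ 1 / 2 →
    ‖montgomeryPhiDeriv m z + (montgomeryCoeff m k : ℂ) / (z - 1 - k * I)‖ ≤ A₃ + A₄ * Real.log (|(k : ℝ)| + 5))
include h18

/-- **`|h_k(v)|` off the window**: `‖h_k(v)‖ ≤ (8M_k/|k|)|v|^{-b̂(k)}` for `1/Λ ≤ |v| ≤ 1/2`
(`M_k = e^{A₁ + A₂ log log(|k|+5)}`). [cite: Montgomery1983, §4 (21)] -/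
theorem norm_pieceFun_le_off {Λ : ℝ} (hΛ : 2 ≤ Λ) {α t : ℝ} (ht : |t| ≤ 1 / 4) {c : ℂ} (hc : ‖c‖ ≤ 1)
    {k : ℤ} (hk : k ≠ 0) {v : ℝ} (hv1 : 1 / Λ ≤ |v|) (hv2 : |v| ≤ 1 / 2) :
    ‖pieceFun m Λ α t c k v‖ ≤ 8 * Real.exp (A₁ + A₂ * Real.log (Real.log (|(k : ℝ)| + 5))) / |(k : ℝ)| *
      |v| ^ (-montgomeryCoeff m k) := by
  have hΛ0 : 0 < Λ := by linarith
  set M := Real.exp (A₁ + A₂ * Real.log (Real.log (|(k : ℝ)| + 5))) with hM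
  have hM0 : 0 < M := Real.exp_pos _
  have hk0 : 0 < |(k : ℝ)| := by have := Int.one_le_abs hk; exact_mod_cast (show (0:ℤ) < |k| by omega)
  have hf := (norm_montgomeryF_line_le m h18 hΛ k hv2).1
  have hw : ‖((1 / Λ : ℝ) : ℂ) + v * I‖ ^ (-montgomeryCoeff m k) ≤ 2 * |v| ^ (-montgomeryCoeff m k) := by
    have := norm_cpow_neg_le_two_mul hΛ0 hv1 (abs_montgomeryCoeff_lt_one m k).le
    rwa [norm_cpow_neg_ofReal] at this
  have hd := norm_pieceDen_ge (α := α) hk ht hv2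
  unfold pieceFun
  rw [norm_div, norm_mul]
  have hden0 : 0 < ‖(α : ℂ) + (((k : ℝ) + v - t : ℝ) : ℂ) * I‖ := by linarith [div_pos hk0 (by norm_num : (0:ℝ) < 4)]
  rw [div_le_iff₀ hden0]
  have hvb : 0 ≤ |v| ^ (-montgomeryCoeff m k) := Real.rpow_nonneg (abs_nonneg v) _
  calc ‖montgomeryF m (zline Λ (k + v))‖ * ‖c‖ ≤ (2 * |v| ^ (-montgomeryCoeff m k) * M) * 1 := by
        refine mul_le_mul (hf.trans ?_) hc (norm_nonneg _) (by positivity)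
        exact mul_le_mul_of_nonneg_right hw hM0.le
    _ = 8 * M / |(k : ℝ)| * |v| ^ (-montgomeryCoeff m k) * (|(k : ℝ)| / 4) := by field_simp; ring
    _ ≤ 8 * M / |(k : ℝ)| * |v| ^ (-montgomeryCoeff m k) * ‖(α : ℂ) + (((k : ℝ) + v - t : ℝ) : ℂ) * I‖ :=
        mul_le_mul_of_nonneg_left hd (by positivity)

/-- **`|h_k(v)|` on the window**: `‖h_k(v)‖ ≤ (4M_k/|k|) Λ^{max(b̂(k),0)}` for `|v| ≤ 1/2`.
[cite: Montgomery1983, §4 (21)] -/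
theorem norm_pieceFun_le_window {Λ : ℝ} (hΛ : 2 ≤ Λ) {α t : ℝ} (ht : |t| ≤ 1 / 4) {c : ℂ} (hc : ‖c‖ ≤ 1)
    {k : ℤ} (hk : k ≠ 0) {v : ℝ} (hv2 : |v| ≤ 1 / 2) :
    ‖pieceFun m Λ α t c k v‖ ≤ 4 * Real.exp (A₁ + A₂ * Real.log (Real.log (|(k : ℝ)| + 5))) / |(k : ℝ)| *
      Λ ^ (max (montgomeryCoeff m k) 0) := by
  have hΛ0 : 0 < Λ := by linarith
  set M := Real.exp (A₁ + A₂ * Real.log (Real.log (|(k : ℝ)| + 5))) with hM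
  have hM0 : 0 < M := Real.exp_pos _
  have hk0 : 0 < |(k : ℝ)| := by have := Int.one_le_abs hk; exact_mod_cast (show (0:ℤ) < |k| by omega)
  have hf := (norm_montgomeryF_line_le m h18 hΛ k hv2).1
  have hw : ‖((1 / Λ : ℝ) : ℂ) + v * I‖ ^ (-montgomeryCoeff m k) ≤ Λ ^ (max (montgomeryCoeff m k) 0) := by
    have := norm_cpow_neg_le_rpow_max (b := montgomeryCoeff m k) hΛ hv2
    rwa [norm_cpow_neg_ofReal] at this
  have hd := norm_pieceDen_ge (α := α) hk ht hv2
  unfold pieceFun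
  rw [norm_div, norm_mul]
  have hden0 : 0 < ‖(α : ℂ) + (((k : ℝ) + v - t : ℝ) : ℂ) * I‖ := by linarith [div_pos hk0 (by norm_num : (0:ℝ) < 4)]
  rw [div_le_iff₀ hden0]
  have hvb : 0 ≤ Λ ^ (max (montgomeryCoeff m k) 0) := Real.rpow_nonneg hΛ0.le _
  calc ‖montgomeryF m (zline Λ (k + v))‖ * ‖c‖ ≤ (Λ ^ (max (montgomeryCoeff m k) 0) * M) * 1 := by
        refine mul_le_mul (hf.trans ?_) hc (norm_nonneg _) (by positivity)
        exact mul_le_mul_of_nonneg_right hw hM0.le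
    _ = 4 * M / |(k : ℝ)| * Λ ^ (max (montgomeryCoeff m k) 0) * (|(k : ℝ)| / 4) := by field_simp
    _ ≤ 4 * M / |(k : ℝ)| * Λ ^ (max (montgomeryCoeff m k) 0) * ‖(α : ℂ) + (((k : ℝ) + v - t : ℝ) : ℂ) * I‖ :=
        mul_le_mul_of_nonneg_left hd (by positivity)

include h19

/-- **`|h_k'(v)|` off the window**: `‖h_k'(v)‖ ≤ (8M_k/|k|)|v|^{-b̂(k)}(|b̂(k)|/|v| + L_k + 4)`,
`L_k = A₃ + A₄ log(|k|+5)`, for `1/Λ ≤ |v| ≤ 1/2`. [cite: Montgomery1983, §4 (21), Lemma 4 (19)] -/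
theorem norm_pieceFunDeriv_le_off (hA₃ : 0 ≤ A₃) (hA₄ : 0 ≤ A₄) {Λ : ℝ} (hΛ : 2 ≤ Λ) {α t : ℝ}
    (ht : |t| ≤ 1 / 4) {c : ℂ} (hc : ‖c‖ ≤ 1) {k : ℤ} (hk : k ≠ 0) {v : ℝ} (hv1 : 1 / Λ ≤ |v|) (hv2 : |v| ≤ 1 / 2) :
    ‖I * c * (deriv (montgomeryF m) (zline Λ (k + v)) / ((α : ℂ) + (((k : ℝ) + v - t : ℝ) : ℂ) * I) -
        montgomeryF m (zline Λ (k + v)) / ((α : ℂ) + (((k : ℝ) + v - t : ℝ) : ℂ) * I) ^ 2)‖ ≤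
      8 * Real.exp (A₁ + A₂ * Real.log (Real.log (|(k : ℝ)| + 5))) / |(k : ℝ)| * |v| ^ (-montgomeryCoeff m k) *
        (|montgomeryCoeff m k| / |v| + (A₃ + A₄ * Real.log (|(k : ℝ)| + 5)) + 4) := by
  have hΛ0 : 0 < Λ := by linarith
  set M := Real.exp (A₁ + A₂ * Real.log (Real.log (|(k : ℝ)| + 5))) with hM
  set L := A₃ + A₄ * Real.log (|(k : ℝ)| + 5) with hL
  have hL0 : 0 ≤ L := by
    rw [hL]; exact add_nonneg hA₃ (mul_nonneg hA₄ ((one_le_log_abs_add_five _).trans' zero_le_one))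
  have hM0 : 0 < M := Real.exp_pos _
  have hk1 : 1 ≤ |(k : ℝ)| := by exact_mod_cast Int.one_le_abs hk
  have hk0 : 0 < |(k : ℝ)| := by linarith
  have hv0 : 0 < |v| := (one_div_pos.2 hΛ0).trans_le hv1
  set d : ℂ := (α : ℂ) + (((k : ℝ) + v - t : ℝ) : ℂ) * I with hdd
  set F : ℂ := montgomeryF m (zline Λ (k + v)) with hF
  set F' : ℂ := deriv (montgomeryF m) (zline Λ (k + v)) with hF'
  have hd := norm_pieceDen_ge (α := α) hk ht hv2
  rw [← hdd] at hd
  have hdpos : 0 < ‖d‖ := by linarith [div_pos hk0 (by norm_num : (0:ℝ) < 4)]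
  have hdinv : 1 / ‖d‖ ≤ 4 / |(k : ℝ)| := by
    rw [div_le_div_iff₀ hdpos hk0]; linarith
  -- `‖F‖ ≤ 2 M |v|^{-b}` and `‖F'‖ ≤ ‖F‖ (|b|/|v| + L)`
  have hf := (norm_montgomeryF_line_le m h18 hΛ k hv2).1
  obtain ⟨hwv, _⟩ := norm_inv_add_mul_I_ge hΛ0 v
  have hw : ‖((1 / Λ : ℝ) : ℂ) + v * I‖ ^ (-montgomeryCoeff m k) ≤ 2 * |v| ^ (-montgomeryCoeff m k) := by
    have := norm_cpow_neg_le_two_mul hΛ0 hv1 (abs_montgomeryCoeff_lt_one m k).le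
    rwa [norm_cpow_neg_ofReal] at this
  have hFle : ‖F‖ ≤ 2 * M * |v| ^ (-montgomeryCoeff m k) := by
    refine hf.trans ?_
    calc ‖((1 / Λ : ℝ) : ℂ) + v * I‖ ^ (-montgomeryCoeff m k) * M ≤ (2 * |v| ^ (-montgomeryCoeff m k)) * M :=
          mul_le_mul_of_nonneg_right hw hM0.le
      _ = _ := by ring
  have hF'le : ‖F'‖ ≤ ‖F‖ * (|montgomeryCoeff m k| / |v| + L) := by
    refine (norm_deriv_montgomeryF_line_le m h19 hΛ k hv2).trans ?_
    refine mul_le_mul_of_nonneg_left (add_le_add ?_ le_rfl) (norm_nonneg _)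
    exact div_le_div_of_nonneg_left (abs_nonneg _) hv0 hwv
  -- combine
  have hvb : 0 ≤ |v| ^ (-montgomeryCoeff m k) := Real.rpow_nonneg (abs_nonneg v) _
  calc ‖I * c * (F' / d - F / d ^ 2)‖ = ‖c‖ * ‖F' / d - F / d ^ 2‖ := by
        rw [norm_mul, norm_mul, norm_I, one_mul]
    _ ≤ 1 * (‖F'‖ / ‖d‖ + ‖F‖ / ‖d‖ ^ 2) := by
        refine mul_le_mul hc ((norm_sub_le _ _).trans (le_of_eq ?_)) (norm_nonneg _) zero_le_one
        rw [norm_div, norm_div, norm_pow]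
    _ = ‖F'‖ * (1 / ‖d‖) + ‖F‖ * (1 / ‖d‖) ^ 2 := by ring
    _ ≤ ‖F‖ * (|montgomeryCoeff m k| / |v| + L) * (4 / |(k : ℝ)|) + ‖F‖ * (4 / |(k : ℝ)|) ^ 2 := by
        gcongr
    _ ≤ (2 * M * |v| ^ (-montgomeryCoeff m k)) * (|montgomeryCoeff m k| / |v| + L) * (4 / |(k : ℝ)|) +
          (2 * M * |v| ^ (-montgomeryCoeff m k)) * (4 / |(k : ℝ)|) ^ 2 := by
        gcongr
    _ = 8 * M / |(k : ℝ)| * |v| ^ (-montgomeryCoeff m k) * (|montgomeryCoeff m k| / |v| + L + 4 / |(k : ℝ)|) := by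
        field_simp; ring
    _ ≤ 8 * M / |(k : ℝ)| * |v| ^ (-montgomeryCoeff m k) * (|montgomeryCoeff m k| / |v| + L + 4) := by
        refine mul_le_mul_of_nonneg_left ?_ (by positivity)
        have : 4 / |(k : ℝ)| ≤ 4 := by rw [div_le_iff₀ hk0]; nlinarith
        linarith

omit h18 h19 in
/-- Continuity of the piece integrand and of its derivative on `|v| ≤ 1/2` (`k ≠ 0`). [folklore] -/
theorem continuousOn_pieceFun {Λ : ℝ} (hΛ : 2 ≤ Λ) {α t : ℝ} (ht : |t| ≤ 1 / 4) (c : ℂ) {k : ℤ} (hk : k ≠ 0) :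
    ContinuousOn (pieceFun m Λ α t c k) (Icc (-(1 / 2)) (1 / 2)) ∧
    ContinuousOn (fun v : ℝ ↦ I * c * (deriv (montgomeryF m) (zline Λ (k + v)) /
        ((α : ℂ) + (((k : ℝ) + v - t : ℝ) : ℂ) * I) -
        montgomeryF m (zline Λ (k + v)) / ((α : ℂ) + (((k : ℝ) + v - t : ℝ) : ℂ) * I) ^ 2))
      (Icc (-(1 / 2)) (1 / 2)) := by
  have hΛ0 : 0 < Λ := by linarith
  have hre1 : ∀ v : ℝ, 1 < (zline Λ (k + v)).re := fun v ↦ by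
    rw [zline_re]; have := one_div_pos.2 hΛ0; linarith
  have hre2 : ∀ v : ℝ, (zline Λ (k + v)).re < 2 := fun v ↦ by
    rw [zline_re]; have : 1 / Λ ≤ 1 / 2 := one_div_le_one_div_of_le (by norm_num) hΛ; linarith
  have hzc : Continuous fun v : ℝ ↦ zline Λ (k + v) := by unfold zline; fun_prop
  have hFc : ∀ v : ℝ, ContinuousAt (fun v : ℝ ↦ montgomeryF m (zline Λ (k + v))) v := fun v ↦
    (differentiableAt_montgomeryF m (hre1 v) (hre2 v)).continuousAt.comp (f := fun v : ℝ ↦ zline Λ (k + v))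
      hzc.continuousAt
  have hF'c : ∀ v : ℝ, ContinuousAt (fun v : ℝ ↦ deriv (montgomeryF m) (zline Λ (k + v))) v := fun v ↦
    (continuousAt_deriv_montgomeryF m (hre1 v) (hre2 v)).comp (f := fun v : ℝ ↦ zline Λ (k + v))
      hzc.continuousAt
  have hdc : Continuous fun v : ℝ ↦ (α : ℂ) + (((k : ℝ) + v - t : ℝ) : ℂ) * I := by fun_prop
  have hd0 : ∀ v ∈ Icc (-(1 / 2) : ℝ) (1 / 2), (α : ℂ) + (((k : ℝ) + v - t : ℝ) : ℂ) * I ≠ 0 :=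
    fun v hv ↦ pieceDen_ne_zero (α := α) hk ht (abs_le.2 ⟨hv.1, hv.2⟩)
  constructor
  · intro v hv
    unfold pieceFun
    exact (((hFc v).mul continuousAt_const).div hdc.continuousAt (hd0 v hv)).continuousWithinAt
  · intro v hv
    refine ContinuousAt.continuousWithinAt ?_
    refine continuousAt_const.mul (((hF'c v).div hdc.continuousAt (hd0 v hv)).sub
      ((hFc v).div (hdc.continuousAt.pow 2) (pow_ne_zero 2 (hd0 v hv))))

omit h18 h19 in
/-- The integral of the derivative bound over `[r, 1/2]`:
`∫_r^{1/2} (8M/|k|) v^{-b}(|b|/v + L + 4) dv ≤ (8M/|k|)(r^{-max(b,0)} + 3(L+4))`. [folklore] -/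
theorem integral_pieceBound_le {M K L b r : ℝ} (hM : 0 ≤ M) (hK : 0 < K) (hL : 0 ≤ L) (hb : b ≤ 2 / 3)
    (hr : 0 < r) (hr2 : r ≤ 1 / 2) :
    ∫ v in r..(1 / 2), 8 * M / K * v ^ (-b) * (|b| / v + L + 4) ≤ 8 * M / K * (r ^ (-(max b 0)) + 3 * (L + 4)) := by
  have hpt : ∀ v ∈ [[r, 1 / 2]], 8 * M / K * v ^ (-b) * (|b| / v + L + 4) =
      8 * M / K * (|b| * v ^ (-b - 1)) + 8 * M / K * ((L + 4) * v ^ (-b)) := by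
    intro v hv
    rw [uIcc_of_le hr2] at hv
    have hv0 : 0 < v := hr.trans_le hv.1
    rw [show -b - 1 = -b + (-1 : ℝ) by ring, Real.rpow_add hv0, Real.rpow_neg_one]
    field_simp
    ring
  rw [intervalIntegral.integral_congr hpt,
    intervalIntegral.integral_add ((intervalIntegrable_rpow_of_pos _ hr hr2).const_mul _ |>.const_mul _)
      ((intervalIntegrable_rpow_of_pos _ hr hr2).const_mul _ |>.const_mul _),
    intervalIntegral.integral_const_mul, intervalIntegral.integral_const_mul,
    intervalIntegral.integral_const_mul, intervalIntegral.integral_const_mul, ← mul_add]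
  refine mul_le_mul_of_nonneg_left (add_le_add (abs_mul_integral_rpow_le hr hr2) ?_) (by positivity)
  calc (L + 4) * ∫ v in r..(1 / 2), v ^ (-b) ≤ (L + 4) * 3 :=
        mul_le_mul_of_nonneg_left (integral_rpow_neg_le_three hr hr2 hb) (by linarith)
    _ = 3 * (L + 4) := by ring

/-- **The `k`-th piece minus its window is small** (`k ≠ 0`; one integration by parts on each side):
for `1/Λ ≤ r ≤ 1/2`,
`‖∫_{-1/2}^{1/2} h_k e^{iΛv} − ∫_{-r}^{r} h_k e^{iΛv}‖ ≤ (16M_k/(Λ|k|))(2r^{-max(b̂(k),0)} + 3L_k + 14)`.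
[cite: Montgomery1983, §4 (21)] -/
theorem norm_piece_sub_window_le (hA₃ : 0 ≤ A₃) (hA₄ : 0 ≤ A₄) {Λ : ℝ} (hΛ : 2 ≤ Λ) {α t : ℝ}
    (ht : |t| ≤ 1 / 4) {c : ℂ} (hc : ‖c‖ ≤ 1) {k : ℤ} (hk : k ≠ 0) {r : ℝ} (hr1 : 1 / Λ ≤ r) (hr2 : r ≤ 1 / 2) :
    ‖(∫ v in (-(1 / 2))..(1 / 2), pieceFun m Λ α t c k v * exp (((Λ * v : ℝ) : ℂ) * I)) -
        ∫ v in (-r)..r, pieceFun m Λ α t c k v * exp (((Λ * v : ℝ) : ℂ) * I)‖ ≤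
      16 * Real.exp (A₁ + A₂ * Real.log (Real.log (|(k : ℝ)| + 5))) / (Λ * |(k : ℝ)|) *
        (2 * r ^ (-(max (montgomeryCoeff m k) 0)) + 3 * (A₃ + A₄ * Real.log (|(k : ℝ)| + 5)) + 14) := by
  have hΛ0 : 0 < Λ := by linarith
  have hr0 : 0 < r := (one_div_pos.2 hΛ0).trans_le hr1
  set M := Real.exp (A₁ + A₂ * Real.log (Real.log (|(k : ℝ)| + 5))) with hM
  set L := A₃ + A₄ * Real.log (|(k : ℝ)| + 5) with hL
  set b := montgomeryCoeff m k with hbdef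
  have hM0 : 0 < M := Real.exp_pos _
  have hL0 : 0 ≤ L := by
    rw [hL]; exact add_nonneg hA₃ (mul_nonneg hA₄ ((one_le_log_abs_add_five _).trans' zero_le_one))
  have hk1 : 1 ≤ |(k : ℝ)| := by exact_mod_cast Int.one_le_abs hk
  have hk0 : 0 < |(k : ℝ)| := by linarith
  have hb23 : b ≤ 2 / 3 := (montgomeryCoeff_le m k).trans (by
    rw [div_le_div_iff₀ Real.pi_pos (by norm_num)]; linarith [Real.pi_gt_three])
  set h : ℝ → ℂ := pieceFun m Λ α t c k with hh
  set h' : ℝ → ℂ := fun v ↦ I * c * (deriv (montgomeryF m) (zline Λ (k + v)) /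
      ((α : ℂ) + (((k : ℝ) + v - t : ℝ) : ℂ) * I) -
      montgomeryF m (zline Λ (k + v)) / ((α : ℂ) + (((k : ℝ) + v - t : ℝ) : ℂ) * I) ^ 2) with hh'
  obtain ⟨hcont, hcont'⟩ := continuousOn_pieceFun m hΛ ht c hk
  have hderiv : ∀ v : ℝ, |v| ≤ 1 / 2 → HasDerivAt h (h' v) v := fun v hv ↦ hasDerivAt_pieceFun m hΛ c hk ht hv
  -- pointwise bounds off the window
  set g : ℝ → ℝ := fun v ↦ 8 * M / |(k : ℝ)| * v ^ (-b) * (|b| / v + L + 4) with hg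
  have hh_off : ∀ v : ℝ, r ≤ |v| → |v| ≤ 1 / 2 → ‖h v‖ ≤ 8 * M / |(k : ℝ)| * |v| ^ (-b) :=
    fun v hv1 hv2 ↦ norm_pieceFun_le_off m h18 hΛ ht hc hk (hr1.trans hv1) hv2
  have hh'_off : ∀ v : ℝ, r ≤ |v| → |v| ≤ 1 / 2 → ‖h' v‖ ≤ g |v| :=
    fun v hv1 hv2 ↦ norm_pieceFunDeriv_le_off m h18 h19 hA₃ hA₄ hΛ ht hc hk (hr1.trans hv1) hv2
  -- boundary values
  have hr_le : r ^ (-b) ≤ r ^ (-(max b 0)) :=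
    Real.rpow_le_rpow_of_exponent_ge hr0 (by linarith) (by simp)
  have hhalf : (1 / 2 : ℝ) ^ (-b) ≤ 2 := by
    rw [Real.div_rpow zero_le_one zero_le_two, Real.one_rpow, Real.rpow_neg zero_le_two, one_div, inv_inv]
    calc (2 : ℝ) ^ b ≤ (2 : ℝ) ^ (1 : ℝ) := Real.rpow_le_rpow_of_exponent_le one_le_two (by linarith)
      _ = 2 := Real.rpow_one _
  have hbd_r : ∀ v : ℝ, |v| = r → ‖h v‖ ≤ 8 * M / |(k : ℝ)| * r ^ (-(max b 0)) := by
    intro v hv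
    refine (hh_off v (by rw [hv]) (by rw [hv]; exact hr2)).trans ?_
    rw [hv]; exact mul_le_mul_of_nonneg_left hr_le (by positivity)
  have hbd_half : ∀ v : ℝ, |v| = 1 / 2 → ‖h v‖ ≤ 8 * M / |(k : ℝ)| * 2 := by
    intro v hv
    refine (hh_off v (by rw [hv]; exact hr2) (by rw [hv])).trans ?_
    rw [hv]; exact mul_le_mul_of_nonneg_left hhalf (by positivity)
  -- the integral of the derivative bound on one side
  have hg_cont : ContinuousOn g (Icc r (1 / 2)) := by
    intro v hv
    have hv0 : 0 < v := hr0.trans_le hv.1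
    simp only [hg]
    exact ((continuousAt_const.mul (Real.continuousAt_rpow_const _ _ (Or.inl hv0.ne'))).mul
      (((continuousAt_const.div continuousAt_id hv0.ne').add continuousAt_const).add continuousAt_const)).continuousWithinAt
  have hIg : ∫ v in r..(1 / 2), g v ≤ 8 * M / |(k : ℝ)| * (r ^ (-(max b 0)) + 3 * (L + 4)) :=
    integral_pieceBound_le hM0.le hk0 hL0 hb23 hr0 hr2
  -- right side `[r, 1/2]`
  have hR : ‖∫ v in r..(1 / 2), h v * exp (((Λ * v : ℝ) : ℂ) * I)‖ ≤
      (8 * M / |(k : ℝ)| * r ^ (-(max b 0)) + 8 * M / |(k : ℝ)| * 2 +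
        8 * M / |(k : ℝ)| * (r ^ (-(max b 0)) + 3 * (L + 4))) / Λ := by
    have hsub : Icc r (1 / 2) ⊆ Icc (-(1 / 2) : ℝ) (1 / 2) := Icc_subset_Icc (by linarith) le_rfl
    refine (norm_integral_mul_exp_le hr2 hΛ0 (fun v hv ↦ hderiv v (abs_le.2 ⟨by linarith [hv.1], hv.2⟩))
      (hcont'.mono hsub)).trans ?_
    refine div_le_div_of_nonneg_right (add_le_add (add_le_add (hbd_r r (abs_of_pos hr0))
      (hbd_half (1 / 2) (abs_of_pos (by norm_num)))) ?_) hΛ0.le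
    refine le_trans (intervalIntegral.integral_mono_on hr2 ?_ (hg_cont.intervalIntegrable_of_Icc hr2)
      fun v hv ↦ ?_) hIg
    · exact ((hcont'.mono hsub).norm).intervalIntegrable_of_Icc hr2
    · have hv0 : 0 < v := hr0.trans_le hv.1
      have := hh'_off v (by rw [abs_of_pos hv0]; exact hv.1) (by rw [abs_of_pos hv0]; exact hv.2)
      rwa [abs_of_pos hv0] at this
  -- left side `[-1/2, -r]`
  have hLft : ‖∫ v in (-(1 / 2))..(-r), h v * exp (((Λ * v : ℝ) : ℂ) * I)‖ ≤
      (8 * M / |(k : ℝ)| * 2 + 8 * M / |(k : ℝ)| * r ^ (-(max b 0)) +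
        8 * M / |(k : ℝ)| * (r ^ (-(max b 0)) + 3 * (L + 4))) / Λ := by
    have hsub : Icc (-(1 / 2) : ℝ) (-r) ⊆ Icc (-(1 / 2) : ℝ) (1 / 2) := Icc_subset_Icc le_rfl (by linarith)
    have hle : -(1 / 2 : ℝ) ≤ -r := by linarith
    refine (norm_integral_mul_exp_le hle hΛ0 (fun v hv ↦ hderiv v (abs_le.2 ⟨hv.1, by linarith [hv.2]⟩))
      (hcont'.mono hsub)).trans ?_
    refine div_le_div_of_nonneg_right (add_le_add (add_le_add
      (hbd_half _ (by rw [abs_neg, abs_of_pos (by norm_num)]))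
      (hbd_r _ (by rw [abs_neg, abs_of_pos hr0]))) ?_) hΛ0.le
    have hcomp : ∫ v in (-(1 / 2))..(-r), g |v| = ∫ v in r..(1 / 2), g v := by
      rw [← intervalIntegral.integral_comp_neg]
      refine intervalIntegral.integral_congr fun v hv ↦ ?_
      rw [uIcc_of_le hr2] at hv
      simp [abs_neg, abs_of_pos (hr0.trans_le hv.1)]
    refine le_trans (intervalIntegral.integral_mono_on hle ?_ ?_ fun v hv ↦ ?_) (hcomp ▸ hIg)
    · exact ((hcont'.mono hsub).norm).intervalIntegrable_of_Icc hle
    · rw [← hcomp] at hIg  -- integrability of `v ↦ g |v|` on `[-1/2, -r]`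
      refine (ContinuousOn.intervalIntegrable_of_Icc hle ?_)
      intro v hv
      have hv0 : v < 0 := by linarith [hv.2]
      have : ContinuousWithinAt (fun v : ℝ ↦ g (-v)) (Icc (-(1 / 2)) (-r)) v := by
        refine ((hg_cont (-v) ⟨by linarith [hv.2], by linarith [hv.1]⟩).comp continuous_neg.continuousWithinAt ?_)
        intro u hu; exact ⟨by linarith [hu.2], by linarith [hu.1]⟩
      refine this.congr (fun u hu ↦ ?_) ?_
      · simp [abs_of_neg (by linarith [hu.2] : u < 0)]
      · simp [abs_of_neg hv0]
    · have hvneg : v < 0 := by linarith [hv.2]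
      exact hh'_off v (by rw [abs_of_neg hvneg]; linarith [hv.2]) (by rw [abs_of_neg hvneg]; linarith [hv.1])
  -- splitting the integral
  have hint : ∀ a₁ a₂ : ℝ, -(1 / 2) ≤ a₁ → a₂ ≤ 1 / 2 → a₁ ≤ a₂ →
      IntervalIntegrable (fun v ↦ h v * exp (((Λ * v : ℝ) : ℂ) * I)) volume a₁ a₂ := by
    intro a₁ a₂ h1 h2 h12
    refine ContinuousOn.intervalIntegrable_of_Icc h12 ?_
    exact (hcont.mono (Icc_subset_Icc h1 h2)).mul (Continuous.continuousOn (by fun_prop))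
  have hsplit : (∫ v in (-(1 / 2))..(1 / 2), h v * exp (((Λ * v : ℝ) : ℂ) * I)) -
      (∫ v in (-r)..r, h v * exp (((Λ * v : ℝ) : ℂ) * I)) =
      (∫ v in (-(1 / 2))..(-r), h v * exp (((Λ * v : ℝ) : ℂ) * I)) +
        ∫ v in r..(1 / 2), h v * exp (((Λ * v : ℝ) : ℂ) * I) := by
    rw [← integral_add_adjacent_intervals (hint _ _ le_rfl (by linarith) (by linarith))
        (hint (-r) (1 / 2) (by linarith) le_rfl (by linarith)),
      ← integral_add_adjacent_intervals (hint (-r) r (by linarith) (by linarith) (by linarith))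
        (hint r (1 / 2) (by linarith) le_rfl hr2)]
    ring
  rw [hsplit]
  refine (norm_add_le _ _).trans ((add_le_add hLft hR).trans (le_of_eq ?_))
  rw [hM.symm.symm] -- no-op to keep `M`
  field_simp
  ring

/-- **A whole piece `k ≠ 0` with the trivial window `r = 1/Λ`**:
`‖∫_{-1/2}^{1/2} h_k e^{iΛv}‖ ≤ (M_k/(Λ|k|))(40 Λ^{max(b̂(k),0)} + 48 L_k + 224)`. [cite: Montgomery1983, §4 (21)] -/
theorem norm_piece_le (hA₃ : 0 ≤ A₃) (hA₄ : 0 ≤ A₄) {Λ : ℝ} (hΛ : 2 ≤ Λ) {α t : ℝ}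
    (ht : |t| ≤ 1 / 4) {c : ℂ} (hc : ‖c‖ ≤ 1) {k : ℤ} (hk : k ≠ 0) :
    ‖∫ v in (-(1 / 2))..(1 / 2), pieceFun m Λ α t c k v * exp (((Λ * v : ℝ) : ℂ) * I)‖ ≤
      Real.exp (A₁ + A₂ * Real.log (Real.log (|(k : ℝ)| + 5))) / (Λ * |(k : ℝ)|) *
        (40 * Λ ^ (max (montgomeryCoeff m k) 0) + 48 * (A₃ + A₄ * Real.log (|(k : ℝ)| + 5)) + 224) := by
  have hΛ0 : 0 < Λ := by linarith
  set M := Real.exp (A₁ + A₂ * Real.log (Real.log (|(k : ℝ)| + 5))) with hM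
  set L := A₃ + A₄ * Real.log (|(k : ℝ)| + 5) with hL
  set P := Λ ^ (max (montgomeryCoeff m k) 0) with hP
  have hM0 : 0 < M := Real.exp_pos _
  have hk0 : 0 < |(k : ℝ)| := by have := Int.one_le_abs hk; exact_mod_cast (show (0:ℤ) < |k| by omega)
  have hP1 : 1 ≤ P := Real.one_le_rpow (by linarith) (le_max_right _ _)
  have hr1 : 1 / Λ ≤ 1 / Λ := le_rfl
  have hr2 : 1 / Λ ≤ 1 / 2 := one_div_le_one_div_of_le (by norm_num) hΛ
  have h1 := norm_piece_sub_window_le m h18 h19 hA₃ hA₄ hΛ (α := α) ht hc hk hr1 hr2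
  have hrpow : (1 / Λ) ^ (-(max (montgomeryCoeff m k) 0)) = P := by
    rw [hP, Real.div_rpow zero_le_one hΛ0.le, Real.one_rpow, Real.rpow_neg hΛ0.le, one_div, inv_inv]
  rw [hrpow] at h1
  -- the window, trivially
  have hwin : ‖∫ v in (-(1 / Λ))..(1 / Λ), pieceFun m Λ α t c k v * exp (((Λ * v : ℝ) : ℂ) * I)‖ ≤
      4 * M / |(k : ℝ)| * P * |1 / Λ - -(1 / Λ)| := by
    refine intervalIntegral.norm_integral_le_of_norm_le_const fun v hv ↦ ?_
    rw [uIoc_of_le (by linarith [one_div_pos.2 hΛ0]), mem_Ioc] at hv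
    rw [norm_mul, norm_exp_ofReal_mul_I, mul_one]
    exact norm_pieceFun_le_window m h18 hΛ ht hc hk (abs_le.2 ⟨by linarith [hv.1, hr2], by linarith [hv.2]⟩)
  have hwin' : ‖∫ v in (-(1 / Λ))..(1 / Λ), pieceFun m Λ α t c k v * exp (((Λ * v : ℝ) : ℂ) * I)‖ ≤
      8 * M * P / (Λ * |(k : ℝ)|) := by
    refine hwin.trans (le_of_eq ?_)
    have h2 : |1 / Λ - -(1 / Λ)| = 2 / Λ := by
      rw [show (1 / Λ - -(1 / Λ) : ℝ) = 2 / Λ by ring, abs_of_pos (div_pos two_pos hΛ0)]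
    rw [h2]
    field_simp
    ring
  calc ‖∫ v in (-(1 / 2))..(1 / 2), pieceFun m Λ α t c k v * exp (((Λ * v : ℝ) : ℂ) * I)‖
      ≤ ‖(∫ v in (-(1 / 2))..(1 / 2), pieceFun m Λ α t c k v * exp (((Λ * v : ℝ) : ℂ) * I)) -
          ∫ v in (-(1 / Λ))..(1 / Λ), pieceFun m Λ α t c k v * exp (((Λ * v : ℝ) : ℂ) * I)‖ +
        ‖∫ v in (-(1 / Λ))..(1 / Λ), pieceFun m Λ α t c k v * exp (((Λ * v : ℝ) : ℂ) * I)‖ :=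
          norm_le_norm_sub_add _ _
    _ ≤ 16 * M / (Λ * |(k : ℝ)|) * (2 * P + 3 * L + 14) + 8 * M * P / (Λ * |(k : ℝ)|) := add_le_add h1 hwin'
    _ = M / (Λ * |(k : ℝ)|) * (40 * P + 48 * L + 224) := by field_simp; ring

/-! ## The piece `k = 1`: the window carries the main term -/

/-- `g₁` along the line near `1 + i`: `g₁(v) = exp(Φ(z) + β log(z − 1 − i))`, `z = zline(1+v)`, so that
`f(z) = (1/Λ + iv)^{-β} g₁(v)` (`β = b̂(1)`; this is `g₁(s) f₂ f₃` of the source at `s = z`).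
[cite: Montgomery1983, Lemma 4 and §4] -/
def gOne (Λ v : ℝ) : ℂ :=
  exp (montgomeryPhi m (zline Λ (1 + v)) + (montgomeryCoeff m 1 : ℂ) * log (((1 / Λ : ℝ) : ℂ) + v * I))

omit h18 h19 in
/-- `f(zline(1+v)) = (1/Λ + iv)^{-β} g₁(v)` (`Λ ≥ 2`). [cite: Montgomery1983, §4] -/
theorem montgomeryF_zline_one_eq {Λ : ℝ} (hΛ : 2 ≤ Λ) (v : ℝ) :
    montgomeryF m (zline Λ (1 + v)) =
      (((1 / Λ : ℝ) : ℂ) + v * I) ^ (-(montgomeryCoeff m 1 : ℂ)) * gOne m Λ v := by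
  have hΛ0 : 0 < Λ := by linarith
  have hre1 : 1 < (zline Λ (1 + v)).re := by rw [zline_re]; have := one_div_pos.2 hΛ0; linarith
  have hw0 := inv_add_mul_I_ne_zero hΛ0 v
  rw [montgomeryF_eq_exp_phi m hre1, gOne, cpow_def_of_ne_zero hw0, ← exp_add]
  congr 1; ring

omit h19 in
/-- `e^{-(A₁ + A₂ log log 6)} ≤ |g₁(v)| ≤ e^{A₁ + A₂ log log 6}` for `|v| ≤ 1/2`, `Λ ≥ 2`. [cite: Montgomery1983, Lemma 4 (18)] -/
theorem norm_gOne_le {Λ : ℝ} (hΛ : 2 ≤ Λ) {v : ℝ} (hv : |v| ≤ 1 / 2) :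
    ‖gOne m Λ v‖ ≤ Real.exp (A₁ + A₂ * Real.log (Real.log 6)) ∧
      Real.exp (-(A₁ + A₂ * Real.log (Real.log 6))) ≤ ‖gOne m Λ v‖ := by
  have hΛ0 : 0 < Λ := by linarith
  set z := zline Λ (1 + v) with hz
  have hre1 : 1 < z.re := by rw [hz, zline_re]; have := one_div_pos.2 hΛ0; linarith
  have hre2 : z.re ≤ 2 := by
    rw [hz, zline_re]; have : 1 / Λ ≤ 1 / 2 := one_div_le_one_div_of_le (by norm_num) hΛ; linarith
  have him : |z.im - (1 : ℤ)| ≤ 1 / 2 := by rw [hz, zline_im]; push_cast; simpa using hv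
  have hG := h18 1 z hre1 hre2 him
  have hzw : z - 1 - ((1 : ℤ) : ℂ) * I = ((1 / Λ : ℝ) : ℂ) + v * I := by
    rw [hz]; have := zline_sub Λ 1 v; simpa only [Int.cast_one] using this
  rw [hzw, show (|((1 : ℤ) : ℝ)| + 5 : ℝ) = 6 by norm_num] at hG
  rw [gOne, norm_exp]
  have hre := abs_re_le_norm (montgomeryPhi m z + (montgomeryCoeff m 1 : ℂ) * log (((1 / Λ : ℝ) : ℂ) + v * I))
  constructor
  · exact Real.exp_le_exp.2 ((le_abs_self _).trans (hre.trans hG))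
  · exact Real.exp_le_exp.2 (by linarith [(abs_le.1 (hre.trans hG)).1])

omit h18 in
/-- **`g₁` is almost constant on the window**: `‖g₁(v) − g₁(0)‖ ≤ 2 L₁ |v| ‖g₁(0)‖` for `|v| ≤ 1/2` with
`L₁|v| ≤ 1`, `L₁ = A₃ + A₄ log 6` (from (19): the logarithmic derivative of `g₁` along the line is
`≤ L₁`). [cite: Montgomery1983, Lemma 4 (19)] -/
theorem norm_gOne_sub_le {Λ : ℝ} (hΛ : 2 ≤ Λ) {v : ℝ} (hv : |v| ≤ 1 / 2)
    (hLv : (A₃ + A₄ * Real.log 6) * |v| ≤ 1) :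
    ‖gOne m Λ v - gOne m Λ 0‖ ≤ 2 * ((A₃ + A₄ * Real.log 6) * |v|) * ‖gOne m Λ 0‖ := by
  have hΛ0 : 0 < Λ := by linarith
  set L₁ := A₃ + A₄ * Real.log 6 with hL₁
  -- the exponent `G(v) = Φ(z) + β log w` and its derivative along the line
  set G : ℝ → ℂ := fun v ↦ montgomeryPhi m (zline Λ (1 + v)) +
    (montgomeryCoeff m 1 : ℂ) * log (((1 / Λ : ℝ) : ℂ) + v * I) with hG
  set G' : ℝ → ℂ := fun v ↦ I * (montgomeryPhiDeriv m (zline Λ (1 + v)) +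
    (montgomeryCoeff m 1 : ℂ) / (((1 / Λ : ℝ) : ℂ) + v * I)) with hG'
  have hre1 : ∀ u : ℝ, 1 < (zline Λ (1 + u)).re := fun u ↦ by
    rw [zline_re]; have := one_div_pos.2 hΛ0; linarith
  have hre2 : ∀ u : ℝ, (zline Λ (1 + u)).re < 2 := fun u ↦ by
    rw [zline_re]; have : 1 / Λ ≤ 1 / 2 := one_div_le_one_div_of_le (by norm_num) hΛ; linarith
  have hderiv : ∀ u : ℝ, HasDerivAt G (G' u) u := by
    intro u
    -- `Φ ∘ zline`
    set g : ℂ → ℂ := fun s ↦ ((1 + 1 / Λ : ℝ) : ℂ) + ((1 : ℂ) + s) * I with hg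
    have hgd : HasDerivAt g I (u : ℂ) := by
      have := ((hasDerivAt_id (u : ℂ)).const_add (1 : ℂ)).mul_const I |>.const_add (((1 + 1 / Λ : ℝ) : ℂ))
      simpa [hg] using this
    have hgu : g u = zline Λ (1 + u) := by simp only [hg, zline]; push_cast; ring
    have hΦ : HasDerivAt (fun s : ℂ ↦ montgomeryPhi m (g s)) (montgomeryPhiDeriv m (zline Λ (1 + u)) * I) (u : ℂ) := by
      have h := (hasDerivAt_montgomeryPhi m (hgu ▸ hre1 u) (hgu ▸ hre2 u)).comp (u : ℂ) hgd
      rw [hgu] at h; exact h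
    have hΦr := hΦ.comp_ofReal
    -- `log w`
    have hw : HasDerivAt (fun s : ℂ ↦ ((1 / Λ : ℝ) : ℂ) + s * I) I (u : ℂ) := by
      simpa using ((hasDerivAt_id (u : ℂ)).mul_const I).const_add (((1 / Λ : ℝ) : ℂ))
    have hlog := (hw.clog (Or.inl (by simp [hΛ0]))).comp_ofReal
    have hsum := hΦr.add (hlog.const_mul (montgomeryCoeff m 1 : ℂ))
    refine (hsum.congr_of_eventuallyEq (Eventually.of_forall fun s ↦ ?_)).congr_deriv ?_
    · simp only [hG, hg, zline, Pi.add_apply]; push_cast; ring_nf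
    · simp only [hG']; field_simp
  have hbound : ∀ u ∈ Icc (-(1 / 2) : ℝ) (1 / 2), ‖G' u‖ ≤ L₁ := by
    intro u hu
    have hu' : |u| ≤ 1 / 2 := abs_le.2 ⟨hu.1, hu.2⟩
    have him : |(zline Λ (1 + u)).im - (1 : ℤ)| ≤ 1 / 2 := by rw [zline_im]; push_cast; simpa using hu'
    have h := h19 1 _ (hre1 u) (hre2 u).le him
    have hzw : zline Λ (1 + u) - 1 - ((1 : ℤ) : ℂ) * I = ((1 / Λ : ℝ) : ℂ) + u * I := by
      have := zline_sub Λ 1 u; simpa only [Int.cast_one] using this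
    rw [hzw, show (|((1 : ℤ) : ℝ)| + 5 : ℝ) = 6 by norm_num] at h
    simp only [hG', norm_mul, norm_I, one_mul]
    exact h
  have hmvt := (convex_Icc (-(1 / 2) : ℝ) (1 / 2)).norm_image_sub_le_of_norm_hasDerivWithin_le
    (fun u _ ↦ (hderiv u).hasDerivWithinAt) hbound
    (show (0 : ℝ) ∈ Icc (-(1 / 2)) (1 / 2) by constructor <;> norm_num) (abs_le.1 hv |> fun h ↦ ⟨h.1, h.2⟩)
  rw [sub_zero, Real.norm_eq_abs] at hmvt
  -- `g₁(v) - g₁(0) = g₁(0) (exp(G v - G 0) - 1)`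
  have hexp : gOne m Λ v - gOne m Λ 0 = gOne m Λ 0 * (exp (G v - G 0) - 1) := by
    show exp (G v) - exp (G 0) = exp (G 0) * (exp (G v - G 0) - 1)
    rw [mul_sub, mul_one, ← exp_add, add_sub_cancel]
  rw [hexp, norm_mul, mul_comm]
  refine mul_le_mul_of_nonneg_right ?_ (norm_nonneg _)
  have hsmall : ‖G v - G 0‖ ≤ 1 := hmvt.trans (by nlinarith [abs_nonneg v])
  exact (norm_exp_sub_one_le hsmall).trans (by linarith)

omit h18 h19 in
/-- `∫_{-w}^{w} |v|^p dv = 2 w^{p+1}/(p+1)` for `p ≥ 0`, `w ≥ 0`. [folklore] -/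
theorem integral_abs_rpow_symm {w p : ℝ} (hw : 0 ≤ w) (hp : 0 ≤ p) :
    ∫ v in (-w)..w, |v| ^ p = 2 * w ^ (p + 1) / (p + 1) := by
  have hint : ∀ a b : ℝ, IntervalIntegrable (fun v : ℝ ↦ |v| ^ p) volume a b := fun a b ↦
    (Continuous.rpow_const (by fun_prop) fun _ ↦ Or.inr hp).intervalIntegrable a b
  rw [← integral_add_adjacent_intervals (hint (-w) 0) (hint 0 w)]
  have h1 : ∫ v in (-w)..0, |v| ^ p = ∫ v in (0 : ℝ)..w, v ^ p := by
    rw [← neg_zero, ← intervalIntegral.integral_comp_neg]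
    simp only [neg_zero]
    refine intervalIntegral.integral_congr fun v hv ↦ ?_
    rw [uIcc_of_le hw] at hv; simp [abs_of_nonneg hv.1]
  have h2 : ∫ v in (0 : ℝ)..w, |v| ^ p = ∫ v in (0 : ℝ)..w, v ^ p := by
    refine intervalIntegral.integral_congr fun v hv ↦ ?_
    rw [uIcc_of_le hw] at hv; simp [abs_of_nonneg hv.1]
  rw [h1, h2, integral_rpow (Or.inl (by linarith)), Real.zero_rpow (by linarith)]
  ring

/-- **The window about `1 + i` carries the main term**: for `1/Λ ≤ w₀ ≤ 1/2` with `L₁ w₀ ≤ 1`,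
`‖∫_{-w₀}^{w₀} h₁ e^{iΛv} − (g₁(0) c/(α + i(1−t))) ∫_{-w₀}^{w₀} (1/Λ+iv)^{-β} e^{iΛv}‖ ≤ (16L₁+32) M₁ w₀^{2−β}`
(`β = b̂(1)`, `M₁ = e^{A₁+A₂ log log 6}`, `L₁ = A₃ + A₄ log 6`): replacing `g₁(v)/(α+i(1+v−t))` by its value
at `v = 0` costs `(8L₁+16)|g₁(0)||v|`, against `|(1/Λ+iv)^{-β}| ≤ |v|^{-β}`. [cite: Montgomery1983, §4 (23)–(24)] -/
theorem norm_windowOne_sub_main_le (hA₃ : 0 ≤ A₃) (hA₄ : 0 ≤ A₄) {Λ : ℝ} (hΛ : 2 ≤ Λ) {α t : ℝ}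
    (ht : |t| ≤ 1 / 4) {c : ℂ} (hc : ‖c‖ ≤ 1) {w₀ : ℝ} (hw1 : 1 / Λ ≤ w₀) (hw2 : w₀ ≤ 1 / 2)
    (hLw : (A₃ + A₄ * Real.log 6) * w₀ ≤ 1) :
    ‖(∫ v in (-w₀)..w₀, pieceFun m Λ α t c 1 v * exp (((Λ * v : ℝ) : ℂ) * I)) -
        (gOne m Λ 0 * c / ((α : ℂ) + ((1 - t : ℝ) : ℂ) * I)) *
          ∫ v in (-w₀)..w₀, (((1 / Λ : ℝ) : ℂ) + v * I) ^ (-(montgomeryCoeff m 1 : ℂ)) *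
            exp (((Λ * v : ℝ) : ℂ) * I)‖ ≤
      (16 * (A₃ + A₄ * Real.log 6) + 32) * Real.exp (A₁ + A₂ * Real.log (Real.log 6)) *
        w₀ ^ (2 - montgomeryCoeff m 1) := by
  have hΛ0 : 0 < Λ := by linarith
  have hw0 : 0 < w₀ := (one_div_pos.2 hΛ0).trans_le hw1
  set β := montgomeryCoeff m 1 with hβ
  have hβ0 : 0 ≤ β := by have := (montgomeryCoeff_one_bounds m).1; rw [hβ]; linarith
  have hβ1 : β < 1 := (abs_lt.1 (abs_montgomeryCoeff_lt_one m 1)).2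
  set L₁ := A₃ + A₄ * Real.log 6 with hL₁
  have hL₁0 : 0 ≤ L₁ := add_nonneg hA₃ (mul_nonneg hA₄ (Real.log_nonneg (by norm_num)))
  set M₁ := Real.exp (A₁ + A₂ * Real.log (Real.log 6)) with hM₁
  set D := gOne m Λ 0 with hD
  have hDM : ‖D‖ ≤ M₁ := (norm_gOne_le m h18 hΛ (v := 0) (by norm_num)).1
  set d : ℝ → ℂ := fun v ↦ (α : ℂ) + (((1 : ℝ) + v - t : ℝ) : ℂ) * I with hdd
  have hd0 : d 0 = (α : ℂ) + ((1 - t : ℝ) : ℂ) * I := by simp [hdd]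
  have hdge : ∀ v : ℝ, |v| ≤ 1 / 2 → 1 / 4 ≤ ‖d v‖ := by
    intro v hv
    have := norm_pieceDen_ge (α := α) (k := 1) one_ne_zero ht hv
    simpa [hdd] using this
  set wf : ℝ → ℂ := fun v ↦ ((1 / Λ : ℝ) : ℂ) + v * I with hwf
  set e : ℝ → ℂ := fun v ↦ exp (((Λ * v : ℝ) : ℂ) * I) with he
  have he1 : ∀ v, ‖e v‖ = 1 := fun v ↦ norm_exp_ofReal_mul_I _
  -- the integrands
  set F₁ : ℝ → ℂ := fun v ↦ pieceFun m Λ α t c 1 v * e v with hF₁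
  set F₂ : ℝ → ℂ := fun v ↦ (D * c / d 0) * ((wf v) ^ (-(β : ℂ)) * e v) with hF₂
  have hcont₁ : ContinuousOn F₁ (Icc (-w₀) w₀) := by
    have := (continuousOn_pieceFun m hΛ (α := α) ht c (k := 1) one_ne_zero).1.mono
      (Icc_subset_Icc (by linarith : -(1 / 2 : ℝ) ≤ -w₀) hw2)
    exact this.mul (Continuous.continuousOn (by fun_prop))
  have hcont₂ : ContinuousOn F₂ (Icc (-w₀) w₀) := by
    refine continuousOn_const.mul (ContinuousOn.mul ?_ (Continuous.continuousOn (by fun_prop)))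
    intro v _
    refine (ContinuousAt.cpow ?_ continuousAt_const (Or.inl (by simp [hwf, hΛ0]))).continuousWithinAt
    simp only [hwf]; fun_prop
  have hint₁ : IntervalIntegrable F₁ volume (-w₀) w₀ := hcont₁.intervalIntegrable_of_Icc (by linarith)
  have hint₂ : IntervalIntegrable F₂ volume (-w₀) w₀ := hcont₂.intervalIntegrable_of_Icc (by linarith)
  -- pointwise difference for `v ≠ 0`
  have hpt : ∀ v : ℝ, v ≠ 0 → |v| ≤ w₀ → ‖F₁ v - F₂ v‖ ≤ (8 * L₁ + 16) * M₁ * |v| ^ (1 - β) := by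
    intro v hv0 hvw
    have hv2 : |v| ≤ 1 / 2 := hvw.trans hw2
    have habs : 0 < |v| := abs_pos.2 hv0
    have hfz : montgomeryF m (zline Λ (1 + v)) = (wf v) ^ (-(β : ℂ)) * gOne m Λ v :=
      montgomeryF_zline_one_eq m hΛ v
    have hdv := hdge v hv2
    have hd00 := hdge 0 (by norm_num)
    have hdvne : d v ≠ 0 := by intro h; rw [h, norm_zero] at hdv; linarith
    have hd0ne : d 0 ≠ 0 := by intro h; rw [h, norm_zero] at hd00; linarith
    have hdiff : F₁ v - F₂ v = c * (wf v) ^ (-(β : ℂ)) * (gOne m Λ v / d v - D / d 0) * e v := by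
      simp only [hF₁, hF₂, pieceFun, Int.cast_one]
      have : (α : ℂ) + (((1 : ℝ) + v - t : ℝ) : ℂ) * I = d v := by simp [hdd]
      rw [this, hfz]
      field_simp
    -- `‖gOne v/d v - D/d 0‖ ≤ (8 L₁ + 16) ‖D‖ |v|`
    have hg := norm_gOne_sub_le m h19 hΛ hv2 (by nlinarith [abs_nonneg v])
    have hquot : ‖gOne m Λ v / d v - D / d 0‖ ≤ (8 * L₁ + 16) * ‖D‖ * |v| := by
      have hsplit : gOne m Λ v / d v - D / d 0 = (gOne m Λ v - D) / d v + D * ((d 0 - d v) / (d v * d 0)) := by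
        field_simp; ring
      have hdd' : d 0 - d v = -(v : ℂ) * I := by simp only [hdd]; push_cast; ring
      rw [hsplit, hdd']
      calc ‖(gOne m Λ v - D) / d v + D * (-(v : ℂ) * I / (d v * d 0))‖
          ≤ ‖(gOne m Λ v - D) / d v‖ + ‖D * (-(v : ℂ) * I / (d v * d 0))‖ := norm_add_le _ _
        _ = ‖gOne m Λ v - D‖ / ‖d v‖ + ‖D‖ * (|v| / (‖d v‖ * ‖d 0‖)) := by
            rw [norm_div, norm_mul, norm_div, norm_mul, norm_mul, norm_neg, norm_real, norm_I, mul_one,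
              Real.norm_eq_abs]
        _ ≤ (2 * (L₁ * |v|) * ‖D‖) / (1 / 4) + ‖D‖ * (|v| / ((1 / 4) * (1 / 4))) := by
            gcongr
        _ = (8 * L₁ + 16) * ‖D‖ * |v| := by ring
    have hwle : ‖(wf v) ^ (-(β : ℂ))‖ ≤ |v| ^ (-β) := by
      rw [norm_cpow_neg_ofReal]
      exact Real.rpow_le_rpow_of_nonpos habs (norm_inv_add_mul_I_ge hΛ0 v).1 (by linarith)
    rw [hdiff, norm_mul, norm_mul, norm_mul, he1, mul_one]
    calc ‖c‖ * ‖wf v ^ (-(β : ℂ))‖ * ‖gOne m Λ v / d v - D / d 0‖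
        ≤ 1 * |v| ^ (-β) * ((8 * L₁ + 16) * ‖D‖ * |v|) := by
          gcongr
      _ ≤ 1 * |v| ^ (-β) * ((8 * L₁ + 16) * M₁ * |v|) := by gcongr
      _ = (8 * L₁ + 16) * M₁ * (|v| ^ (-β) * |v|) := by ring
      _ = (8 * L₁ + 16) * M₁ * |v| ^ (1 - β) := by
          rw [show 1 - β = -β + 1 by ring, Real.rpow_add habs, Real.rpow_one]
  -- integrate
  have hmain : ‖(∫ v in (-w₀)..w₀, F₁ v) - ∫ v in (-w₀)..w₀, F₂ v‖ ≤
      ∫ v in (-w₀)..w₀, (8 * L₁ + 16) * M₁ * |v| ^ (1 - β) := by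
    rw [← intervalIntegral.integral_sub hint₁ hint₂]
    refine intervalIntegral.norm_integral_le_of_norm_le (by linarith) ?_ ?_
    · filter_upwards [measure_eq_zero_iff_ae_notMem.1 (measure_singleton (0 : ℝ))] with v hv0 hv
      exact hpt v (fun h ↦ hv0 (by simp [h])) (abs_le.2 ⟨hv.1.le, hv.2⟩)
    · exact ((Continuous.rpow_const (by fun_prop) fun _ ↦ Or.inr (by linarith)).const_mul _).intervalIntegrable _ _
  have hval : ∫ v in (-w₀)..w₀, (8 * L₁ + 16) * M₁ * |v| ^ (1 - β) =
      (8 * L₁ + 16) * M₁ * (2 * w₀ ^ (1 - β + 1) / (1 - β + 1)) := by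
    rw [intervalIntegral.integral_const_mul, integral_abs_rpow_symm hw0.le (by linarith)]
  have hF₂' : (∫ v in (-w₀)..w₀, F₂ v) = (D * c / d 0) *
      ∫ v in (-w₀)..w₀, (wf v) ^ (-(β : ℂ)) * e v := intervalIntegral.integral_const_mul _ _
  rw [← hd0]
  change ‖(∫ v in (-w₀)..w₀, F₁ v) - (D * c / d 0) * ∫ v in (-w₀)..w₀, (wf v) ^ (-(β : ℂ)) * e v‖ ≤ _
  rw [← hF₂']
  refine hmain.trans ?_
  rw [hval, show 1 - β + 1 = 2 - β by ring]
  have h2β : 1 ≤ 2 - β := by linarith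
  have hpos : 0 ≤ w₀ ^ (2 - β) := Real.rpow_nonneg hw0.le _
  have hM₁0 : 0 < M₁ := Real.exp_pos _
  calc (8 * L₁ + 16) * M₁ * (2 * w₀ ^ (2 - β) / (2 - β)) ≤ (8 * L₁ + 16) * M₁ * (2 * w₀ ^ (2 - β) / 1) := by
        gcongr
    _ = (16 * L₁ + 32) * M₁ * w₀ ^ (2 - β) := by ring

/-! ## The piece `k = 0`: `f` vanishes like `|v|^{β₀}` at `1`, the kernel has the pole `1/(α+i(v−t))` -/

omit h18 h19 in
/-- The denominator of the piece `k = 0`: if `|t| ≤ a = |α|/2` then `(a + |v|)/2 ≤ |α + i(v − t)|`. [folklore] -/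
theorem norm_pieceDen_zero_ge {α t v : ℝ} (ht : |t| ≤ |α| / 2) :
    (|α| / 2 + |v|) / 2 ≤ ‖(α : ℂ) + ((((0 : ℤ) : ℝ) + v - t : ℝ) : ℂ) * I‖ := by
  set N : ℝ := ‖(α : ℂ) + ((((0 : ℤ) : ℝ) + v - t : ℝ) : ℂ) * I‖ with hN
  have h1 : |α| ≤ N := by
    calc |α| = |((α : ℂ) + ((((0 : ℤ) : ℝ) + v - t : ℝ) : ℂ) * I).re| := by simp
      _ ≤ _ := abs_re_le_norm _
  have h2 : |v| - |t| ≤ N := by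
    calc |v| - |t| ≤ |v - t| := by
          have := abs_sub_abs_le_abs_sub v t; linarith
      _ = |((α : ℂ) + ((((0 : ℤ) : ℝ) + v - t : ℝ) : ℂ) * I).im| := by simp
      _ ≤ _ := abs_im_le_norm _
  linarith

omit h18 h19 in
/-- The derivative of the piece integrand for `k = 0` (`α ≠ 0`, `|t| ≤ |α|/2`). [folklore] -/
theorem hasDerivAt_pieceFun_zero {Λ : ℝ} (hΛ : 2 ≤ Λ) {α t : ℝ} (hα : α ≠ 0) (ht : |t| ≤ |α| / 2)
    (c : ℂ) (v : ℝ) :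
    HasDerivAt (pieceFun m Λ α t c 0)
      (I * c * (deriv (montgomeryF m) (zline Λ ((0 : ℤ) + v)) / ((α : ℂ) + ((((0 : ℤ) : ℝ) + v - t : ℝ) : ℂ) * I) -
        montgomeryF m (zline Λ ((0 : ℤ) + v)) / ((α : ℂ) + ((((0 : ℤ) : ℝ) + v - t : ℝ) : ℂ) * I) ^ 2)) v := by
  have hd0 : (α : ℂ) + ((((0 : ℤ) : ℝ) + v - t : ℝ) : ℂ) * I ≠ 0 := by
    intro h
    have := norm_pieceDen_zero_ge (v := v) ht
    rw [h, norm_zero] at this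
    have : 0 < |α| := abs_pos.2 hα
    linarith [abs_nonneg v]
  have hden : HasDerivAt (fun v : ℝ ↦ (α : ℂ) + ((((0 : ℤ) : ℝ) + v - t : ℝ) : ℂ) * I) I v := by
    have h1 : HasDerivAt (fun u : ℂ ↦ (α : ℂ) + (((0 : ℤ) : ℂ) + u - t) * I) I (v : ℂ) := by
      have := (((hasDerivAt_id (v : ℂ)).const_add ((0 : ℤ) : ℂ)).sub_const (t : ℂ)).mul_const I |>.const_add (α : ℂ)
      simpa using this
    have h2 := h1.comp_ofReal
    refine h2.congr_of_eventuallyEq (Eventually.of_forall fun u ↦ ?_)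
    push_cast
    ring_nf
  have hnum : HasDerivAt (fun v : ℝ ↦ montgomeryF m (zline Λ ((0 : ℤ) + v)) * c)
      (deriv (montgomeryF m) (zline Λ ((0 : ℤ) + v)) * I * c) v :=
    (hasDerivAt_montgomeryF_zline m hΛ 0 v).mul_const c
  have h := hnum.div hden hd0
  unfold pieceFun
  refine h.congr_deriv ?_
  field_simp

/-- **Bounds for the piece `k = 0`** (`β₀ = −b̂(0) ∈ (0,1)`, `a = |α|/2`, `|t| ≤ a`, `M₀ = e^{A₁+A₂ log log 5}`,
`L₀ = A₃ + A₄ log 5`): on the window `|v| ≤ 1/Λ`, `‖h₀(v)‖ ≤ 2M₀(2/Λ)^{β₀}/a`; off it,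
`‖h₀(v)‖ ≤ 4M₀|v|^{β₀}/(a+|v|)` and `‖h₀'(v)‖ ≤ 4M₀(β₀|v|^{β₀−1}/(a+|v|) + L₀|v|^{β₀}/(a+|v|) + 2|v|^{β₀}/(a+|v|)²)`.
[cite: Montgomery1983, §4 (the modification near `k = 0`)] -/
theorem norm_pieceFun_zero_le (hA₃ : 0 ≤ A₃) (hA₄ : 0 ≤ A₄) {Λ : ℝ} (hΛ : 2 ≤ Λ) {α t : ℝ} (hα : α ≠ 0)
    (ht : |t| ≤ |α| / 2) {c : ℂ} (hc : ‖c‖ ≤ 1) {v : ℝ} (hv2 : |v| ≤ 1 / 2) :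
    (|v| ≤ 1 / Λ → ‖pieceFun m Λ α t c 0 v‖ ≤
      2 * Real.exp (A₁ + A₂ * Real.log (Real.log 5)) * (2 / Λ) ^ (-montgomeryCoeff m 0) / (|α| / 2)) ∧
    (1 / Λ ≤ |v| → ‖pieceFun m Λ α t c 0 v‖ ≤
      4 * Real.exp (A₁ + A₂ * Real.log (Real.log 5)) * |v| ^ (-montgomeryCoeff m 0) / (|α| / 2 + |v|)) ∧
    (1 / Λ ≤ |v| → ‖I * c * (deriv (montgomeryF m) (zline Λ ((0 : ℤ) + v)) /
        ((α : ℂ) + ((((0 : ℤ) : ℝ) + v - t : ℝ) : ℂ) * I) -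
        montgomeryF m (zline Λ ((0 : ℤ) + v)) / ((α : ℂ) + ((((0 : ℤ) : ℝ) + v - t : ℝ) : ℂ) * I) ^ 2)‖ ≤
      4 * Real.exp (A₁ + A₂ * Real.log (Real.log 5)) *
        ((-montgomeryCoeff m 0) * |v| ^ (-montgomeryCoeff m 0 - 1) / (|α| / 2 + |v|) +
          (A₃ + A₄ * Real.log 5) * |v| ^ (-montgomeryCoeff m 0) / (|α| / 2 + |v|) +
          2 * |v| ^ (-montgomeryCoeff m 0) / (|α| / 2 + |v|) ^ 2)) := by
  have hΛ0 : 0 < Λ := by linarith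
  set β₀ := -montgomeryCoeff m 0 with hβ₀
  have hβ₀0 : 0 < β₀ := by rw [hβ₀]; linarith [(montgomeryCoeff_zero_bounds m).2]
  have hβ₀1 : β₀ < 1 := by rw [hβ₀]; linarith [(montgomeryCoeff_zero_bounds m).1]
  set M₀ := Real.exp (A₁ + A₂ * Real.log (Real.log 5)) with hM₀
  set L₀ := A₃ + A₄ * Real.log 5 with hL₀
  have hM₀0 : 0 < M₀ := Real.exp_pos _
  have hL₀0 : 0 ≤ L₀ := add_nonneg hA₃ (mul_nonneg hA₄ (Real.log_nonneg (by norm_num)))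
  set a := |α| / 2 with ha
  have ha0 : 0 < a := by rw [ha]; exact div_pos (abs_pos.2 hα) two_pos
  set d : ℂ := (α : ℂ) + ((((0 : ℤ) : ℝ) + v - t : ℝ) : ℂ) * I with hdd
  have hd := norm_pieceDen_zero_ge (v := v) ht
  rw [← hdd, ← ha] at hd
  have hdpos : 0 < ‖d‖ := by linarith [abs_nonneg v]
  have hdinv : 1 / ‖d‖ ≤ 2 / (a + |v|) := by
    rw [div_le_div_iff₀ hdpos (by linarith [abs_nonneg v])]; linarith
  set w : ℂ := ((1 / Λ : ℝ) : ℂ) + v * I with hw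
  set F : ℂ := montgomeryF m (zline Λ ((0 : ℤ) + v)) with hF
  set F' : ℂ := deriv (montgomeryF m) (zline Λ ((0 : ℤ) + v)) with hF'
  -- `‖F‖ ≤ ‖w‖^{β₀} M₀`
  have hf := (norm_montgomeryF_line_le m h18 hΛ 0 hv2).1
  rw [show (|((0 : ℤ) : ℝ)| + 5 : ℝ) = 5 by norm_num, ← hβ₀, ← hw, ← hM₀, ← hF] at hf
  have hf' : ‖F‖ ≤ ‖w‖ ^ β₀ * M₀ := hf
  obtain ⟨hwv, hwL⟩ := norm_inv_add_mul_I_ge hΛ0 v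
  have hwle := norm_inv_add_mul_I_le hΛ0 v
  rw [← hw] at hwv hwL hwle
  refine ⟨fun hv1 ↦ ?_, fun hv1 ↦ ?_, fun hv1 ↦ ?_⟩
  · -- window
    have h2L : (2 : ℝ) / Λ = 1 / Λ + 1 / Λ := by ring
    have hw2 : ‖w‖ ^ β₀ ≤ (2 / Λ) ^ β₀ :=
      Real.rpow_le_rpow (norm_nonneg _) (by linarith) hβ₀0.le
    unfold pieceFun
    rw [norm_div, norm_mul, ← hdd, div_le_iff₀ hdpos]
    have ha2 : a ≤ 2 * ‖d‖ := by linarith [abs_nonneg v]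
    calc ‖F‖ * ‖c‖ ≤ ((2 / Λ) ^ β₀ * M₀) * 1 :=
          mul_le_mul (hf'.trans (mul_le_mul_of_nonneg_right hw2 hM₀0.le)) hc (norm_nonneg _) (by positivity)
      _ = 2 * M₀ * (2 / Λ) ^ β₀ / a * (a / 2) := by field_simp
      _ ≤ 2 * M₀ * (2 / Λ) ^ β₀ / a * ‖d‖ := mul_le_mul_of_nonneg_left (by linarith) (by positivity)
  · -- off the window, the function
    have hv0 : 0 < |v| := (one_div_pos.2 hΛ0).trans_le hv1
    have hw2 : ‖w‖ ^ β₀ ≤ 2 * |v| ^ β₀ := by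
      have := norm_cpow_neg_le_two_mul (b := montgomeryCoeff m 0) hΛ0 hv1 (abs_montgomeryCoeff_lt_one m 0).le
      rwa [norm_cpow_neg_ofReal, ← hβ₀] at this
    unfold pieceFun
    rw [norm_div, norm_mul, ← hdd, div_le_iff₀ hdpos]
    calc ‖F‖ * ‖c‖ ≤ (2 * |v| ^ β₀ * M₀) * 1 :=
          mul_le_mul (hf'.trans (mul_le_mul_of_nonneg_right hw2 hM₀0.le)) hc (norm_nonneg _) (by positivity)
      _ = 4 * M₀ * |v| ^ β₀ / (a + |v|) * ((a + |v|) / 2) := by field_simp; ring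
      _ ≤ 4 * M₀ * |v| ^ β₀ / (a + |v|) * ‖d‖ := mul_le_mul_of_nonneg_left hd (by positivity)
  · -- off the window, the derivative
    have hv0 : 0 < |v| := (one_div_pos.2 hΛ0).trans_le hv1
    have hw2 : ‖w‖ ^ β₀ ≤ 2 * |v| ^ β₀ := by
      have := norm_cpow_neg_le_two_mul (b := montgomeryCoeff m 0) hΛ0 hv1 (abs_montgomeryCoeff_lt_one m 0).le
      rwa [norm_cpow_neg_ofReal, ← hβ₀] at this
    have hFle : ‖F‖ ≤ 2 * M₀ * |v| ^ β₀ := hf'.trans (by nlinarith [hM₀0.le])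
    have hF'le : ‖F'‖ ≤ ‖F‖ * (β₀ / |v| + L₀) := by
      have h := norm_deriv_montgomeryF_line_le m h19 hΛ 0 hv2
      rw [show (|((0 : ℤ) : ℝ)| + 5 : ℝ) = 5 by norm_num, ← hw, ← hF, ← hF', ← hL₀] at h
      refine h.trans (mul_le_mul_of_nonneg_left (add_le_add ?_ le_rfl) (norm_nonneg _))
      have hb0 : |montgomeryCoeff m 0| = β₀ := by rw [hβ₀, abs_of_neg (montgomeryCoeff_zero_bounds m).2]
      rw [hb0]
      exact div_le_div_of_nonneg_left hβ₀0.le hv0 hwv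
    have hvb : 0 ≤ |v| ^ β₀ := Real.rpow_nonneg (abs_nonneg v) _
    calc ‖I * c * (F' / d - F / d ^ 2)‖ = ‖c‖ * ‖F' / d - F / d ^ 2‖ := by
          rw [norm_mul, norm_mul, norm_I, one_mul]
      _ ≤ 1 * (‖F'‖ / ‖d‖ + ‖F‖ / ‖d‖ ^ 2) := by
          refine mul_le_mul hc ((norm_sub_le _ _).trans (le_of_eq ?_)) (norm_nonneg _) zero_le_one
          rw [norm_div, norm_div, norm_pow]
      _ = ‖F'‖ * (1 / ‖d‖) + ‖F‖ * (1 / ‖d‖) ^ 2 := by ring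
      _ ≤ ‖F‖ * (β₀ / |v| + L₀) * (2 / (a + |v|)) + ‖F‖ * (2 / (a + |v|)) ^ 2 := by gcongr
      _ ≤ (2 * M₀ * |v| ^ β₀) * (β₀ / |v| + L₀) * (2 / (a + |v|)) + (2 * M₀ * |v| ^ β₀) * (2 / (a + |v|)) ^ 2 := by
          gcongr
      _ = 4 * M₀ * (β₀ * (|v| ^ β₀ / |v|) / (a + |v|) + L₀ * |v| ^ β₀ / (a + |v|) +
            2 * |v| ^ β₀ / (a + |v|) ^ 2) := by
          field_simp; ring
      _ = _ := by rw [Real.rpow_sub_one hv0.ne']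

omit h18 h19 in
/-- Continuity of the piece integrand `k = 0` and of its derivative (`α ≠ 0`, `|t| ≤ |α|/2`). [folklore] -/
theorem continuousOn_pieceFun_zero {Λ : ℝ} (hΛ : 2 ≤ Λ) {α t : ℝ} (hα : α ≠ 0) (ht : |t| ≤ |α| / 2) (c : ℂ) :
    Continuous (pieceFun m Λ α t c 0) ∧
    Continuous (fun v : ℝ ↦ I * c * (deriv (montgomeryF m) (zline Λ ((0 : ℤ) + v)) /
        ((α : ℂ) + ((((0 : ℤ) : ℝ) + v - t : ℝ) : ℂ) * I) -
        montgomeryF m (zline Λ ((0 : ℤ) + v)) / ((α : ℂ) + ((((0 : ℤ) : ℝ) + v - t : ℝ) : ℂ) * I) ^ 2)) := by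
  have hΛ0 : 0 < Λ := by linarith
  have hre1 : ∀ v : ℝ, 1 < (zline Λ ((0 : ℤ) + v)).re := fun v ↦ by
    rw [zline_re]; have := one_div_pos.2 hΛ0; linarith
  have hre2 : ∀ v : ℝ, (zline Λ ((0 : ℤ) + v)).re < 2 := fun v ↦ by
    rw [zline_re]; have : 1 / Λ ≤ 1 / 2 := one_div_le_one_div_of_le (by norm_num) hΛ; linarith
  have hzc : Continuous fun v : ℝ ↦ zline Λ ((0 : ℤ) + v) := by unfold zline; fun_prop
  have hFc : Continuous (fun v : ℝ ↦ montgomeryF m (zline Λ ((0 : ℤ) + v))) :=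
    continuous_iff_continuousAt.2 fun v ↦
      (differentiableAt_montgomeryF m (hre1 v) (hre2 v)).continuousAt.comp
        (f := fun v : ℝ ↦ zline Λ ((0 : ℤ) + v)) hzc.continuousAt
  have hF'c : Continuous (fun v : ℝ ↦ deriv (montgomeryF m) (zline Λ ((0 : ℤ) + v))) :=
    continuous_iff_continuousAt.2 fun v ↦
      (continuousAt_deriv_montgomeryF m (hre1 v) (hre2 v)).comp (f := fun v : ℝ ↦ zline Λ ((0 : ℤ) + v))
        hzc.continuousAt
  have hdc : Continuous fun v : ℝ ↦ (α : ℂ) + ((((0 : ℤ) : ℝ) + v - t : ℝ) : ℂ) * I := by fun_prop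
  have hd0 : ∀ v : ℝ, (α : ℂ) + ((((0 : ℤ) : ℝ) + v - t : ℝ) : ℂ) * I ≠ 0 := by
    intro v h
    have := norm_pieceDen_zero_ge (v := v) ht
    rw [h, norm_zero] at this
    linarith [abs_nonneg v, abs_pos.2 hα]
  constructor
  · unfold pieceFun
    exact (hFc.mul continuous_const).div hdc hd0
  · exact continuous_const.mul ((hF'c.div hdc hd0).sub (hFc.div (hdc.pow 2) fun v ↦ pow_ne_zero 2 (hd0 v)))

omit h18 h19 in
/-- The integral of the derivative bound for `k = 0` over `[1/Λ, 1/2]`. [folklore] -/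
theorem integral_pieceZeroBound_le {M L β₀ a r : ℝ} (hM : 0 ≤ M) (hL : 0 ≤ L) (hβ₀ : 0 < β₀) (hβ₁ : β₀ < 1)
    (hr : 0 < r) (hra : r ≤ a) (ha : a ≤ 1 / 2) :
    ∫ v in r..(1 / 2), 4 * M * (β₀ * v ^ (β₀ - 1) / (a + v) + L * v ^ β₀ / (a + v) + 2 * v ^ β₀ / (a + v) ^ 2) ≤
      4 * M * (a ^ (β₀ - 1) * (3 + 3 / (1 - β₀)) + L / β₀) := by
  have ha0 : 0 < a := hr.trans_le hra
  have hr2 : r ≤ 1 / 2 := hra.trans ha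
  have hc : ∀ (p : ℝ) (n : ℕ), ContinuousOn (fun v : ℝ ↦ v ^ p / (a + v) ^ n) (Icc r (1 / 2)) := by
    intro p n v hv
    have hv0 : 0 < v := hr.trans_le hv.1
    exact ((Real.continuousAt_rpow_const _ _ (Or.inl hv0.ne')).div (by fun_prop) (by positivity)).continuousWithinAt
  have hcm : ∀ (κ p : ℝ) (n : ℕ), ContinuousOn (fun v : ℝ ↦ κ * v ^ p / (a + v) ^ n) (Icc r (1 / 2)) := by
    intro κ p n v hv
    have hv0 : 0 < v := hr.trans_le hv.1
    exact ((continuousAt_const.mul (Real.continuousAt_rpow_const _ _ (Or.inl hv0.ne'))).div (by fun_prop)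
      (by positivity)).continuousWithinAt
  have hI1 : IntervalIntegrable (fun v : ℝ ↦ β₀ * v ^ (β₀ - 1) / (a + v)) volume r (1 / 2) := by
    simpa using (hcm β₀ (β₀ - 1) 1).intervalIntegrable_of_Icc hr2
  have hI2 : IntervalIntegrable (fun v : ℝ ↦ L * v ^ β₀ / (a + v)) volume r (1 / 2) := by
    simpa using (hcm L β₀ 1).intervalIntegrable_of_Icc hr2
  have hI3 : IntervalIntegrable (fun v : ℝ ↦ 2 * v ^ β₀ / (a + v) ^ 2) volume r (1 / 2) :=
    (hcm 2 β₀ 2).intervalIntegrable_of_Icc hr2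
  have h1 := integral_rpow_div_add_le₁ hr hra ha hβ₀ hβ₁
  have h2 := integral_rpow_div_add_le₂ hr hr2 ha0 hβ₀
  have h3 := integral_rpow_div_add_sq_le hr hra ha hβ₀ hβ₁
  have e1 : ∫ v in r..(1 / 2), β₀ * v ^ (β₀ - 1) / (a + v) = β₀ * ∫ v in r..(1 / 2), v ^ (β₀ - 1) / (a + v) := by
    rw [← intervalIntegral.integral_const_mul]
    exact intervalIntegral.integral_congr fun v _ ↦ by ring
  have e2 : ∫ v in r..(1 / 2), L * v ^ β₀ / (a + v) = L * ∫ v in r..(1 / 2), v ^ β₀ / (a + v) := by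
    rw [← intervalIntegral.integral_const_mul]
    exact intervalIntegral.integral_congr fun v _ ↦ by ring
  have e3 : ∫ v in r..(1 / 2), 2 * v ^ β₀ / (a + v) ^ 2 = 2 * ∫ v in r..(1 / 2), v ^ β₀ / (a + v) ^ 2 := by
    rw [← intervalIntegral.integral_const_mul]
    exact intervalIntegral.integral_congr fun v _ ↦ by ring
  have hsplit : ∫ v in r..(1 / 2), 4 * M * (β₀ * v ^ (β₀ - 1) / (a + v) + L * v ^ β₀ / (a + v) + 2 * v ^ β₀ / (a + v) ^ 2) =
      4 * M * (β₀ * (∫ v in r..(1 / 2), v ^ (β₀ - 1) / (a + v)) + L * (∫ v in r..(1 / 2), v ^ β₀ / (a + v)) +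
        2 * ∫ v in r..(1 / 2), v ^ β₀ / (a + v) ^ 2) := by
    rw [intervalIntegral.integral_const_mul, intervalIntegral.integral_add (hI1.add hI2) hI3,
      intervalIntegral.integral_add hI1 hI2, e1, e2, e3]
  rw [hsplit]
  refine mul_le_mul_of_nonneg_left ?_ (by positivity)
  have hapos : 0 ≤ a ^ (β₀ - 1) := Real.rpow_nonneg ha0.le _
  have hb1 : 0 < 1 - β₀ := by linarith
  calc β₀ * (∫ v in r..(1 / 2), v ^ (β₀ - 1) / (a + v)) + L * (∫ v in r..(1 / 2), v ^ β₀ / (a + v)) +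
        2 * ∫ v in r..(1 / 2), v ^ β₀ / (a + v) ^ 2
      ≤ β₀ * (a ^ (β₀ - 1) * (1 / β₀ + 1 / (1 - β₀))) + L * (1 / β₀) + 2 * (a ^ (β₀ - 1) * (1 + 1 / (1 - β₀))) := by
        gcongr
    _ = a ^ (β₀ - 1) * (3 + (β₀ + 2) / (1 - β₀)) + L / β₀ := by field_simp; ring
    _ ≤ a ^ (β₀ - 1) * (3 + 3 / (1 - β₀)) + L / β₀ := by
        gcongr a ^ (β₀ - 1) * (3 + ?_ / (1 - β₀)) + _
        linarith

/-- **The piece `k = 0` is small** (`a = |α|/2`, `|t| ≤ a`, `1/Λ ≤ a ≤ 1/2`):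
`‖∫_{-1/2}^{1/2} h₀ e^{iΛv}‖ ≤ 4M₀(2/Λ)^{β₀}/(Λa) + (8M₀/Λ)(Λ^{-β₀}/a + 2 + a^{β₀−1}(3 + 3/(1−β₀)) + L₀/β₀)`.
[cite: Montgomery1983, §4 (the contribution of the neighbourhood of `w = 1 − s`)] -/
theorem norm_pieceZero_le (hA₃ : 0 ≤ A₃) (hA₄ : 0 ≤ A₄) {Λ : ℝ} (hΛ : 2 ≤ Λ) {α t : ℝ} (hα : α ≠ 0)
    (ht : |t| ≤ |α| / 2) {c : ℂ} (hc : ‖c‖ ≤ 1) (ha1 : 1 / Λ ≤ |α| / 2) (ha2 : |α| / 2 ≤ 1 / 2) :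
    ‖∫ v in (-(1 / 2))..(1 / 2), pieceFun m Λ α t c 0 v * exp (((Λ * v : ℝ) : ℂ) * I)‖ ≤
      4 * Real.exp (A₁ + A₂ * Real.log (Real.log 5)) * (2 / Λ) ^ (-montgomeryCoeff m 0) / (Λ * (|α| / 2)) +
      8 * Real.exp (A₁ + A₂ * Real.log (Real.log 5)) / Λ *
        (Λ ^ (montgomeryCoeff m 0) / (|α| / 2) + 2 +
          (|α| / 2) ^ (-montgomeryCoeff m 0 - 1) * (3 + 3 / (1 - -montgomeryCoeff m 0)) +
          (A₃ + A₄ * Real.log 5) / (-montgomeryCoeff m 0)) := by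
  have hΛ0 : 0 < Λ := by linarith
  set β₀ := -montgomeryCoeff m 0 with hβ₀
  have hβ₀0 : 0 < β₀ := by rw [hβ₀]; linarith [(montgomeryCoeff_zero_bounds m).2]
  have hβ₀1 : β₀ < 1 := by rw [hβ₀]; linarith [(montgomeryCoeff_zero_bounds m).1]
  set M₀ := Real.exp (A₁ + A₂ * Real.log (Real.log 5)) with hM₀
  set L₀ := A₃ + A₄ * Real.log 5 with hL₀
  have hM₀0 : 0 < M₀ := Real.exp_pos _
  have hL₀0 : 0 ≤ L₀ := add_nonneg hA₃ (mul_nonneg hA₄ (Real.log_nonneg (by norm_num)))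
  set a := |α| / 2 with ha
  have ha0 : 0 < a := by rw [ha]; exact div_pos (abs_pos.2 hα) two_pos
  have hr0 : 0 < 1 / Λ := one_div_pos.2 hΛ0
  have hr2 : 1 / Λ ≤ 1 / 2 := ha1.trans ha2
  set h : ℝ → ℂ := pieceFun m Λ α t c 0 with hh
  set h' : ℝ → ℂ := fun v ↦ I * c * (deriv (montgomeryF m) (zline Λ ((0 : ℤ) + v)) /
      ((α : ℂ) + ((((0 : ℤ) : ℝ) + v - t : ℝ) : ℂ) * I) -
      montgomeryF m (zline Λ ((0 : ℤ) + v)) / ((α : ℂ) + ((((0 : ℤ) : ℝ) + v - t : ℝ) : ℂ) * I) ^ 2) with hh'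
  obtain ⟨hcont, hcont'⟩ := continuousOn_pieceFun_zero m hΛ hα ht c
  have hderiv : ∀ v : ℝ, HasDerivAt h (h' v) v := fun v ↦ hasDerivAt_pieceFun_zero m hΛ hα ht c v
  have hB := fun v (hv : |v| ≤ 1 / 2) ↦ norm_pieceFun_zero_le m h18 h19 hA₃ hA₄ hΛ hα ht hc hv
  -- the bound function for `h'`
  set g : ℝ → ℝ := fun v ↦ 4 * M₀ * (β₀ * v ^ (β₀ - 1) / (a + v) + L₀ * v ^ β₀ / (a + v) +
    2 * v ^ β₀ / (a + v) ^ 2) with hg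
  have hIg : ∫ v in (1 / Λ)..(1 / 2), g v ≤ 4 * M₀ * (a ^ (β₀ - 1) * (3 + 3 / (1 - β₀)) + L₀ / β₀) :=
    integral_pieceZeroBound_le hM₀0.le hL₀0 hβ₀0 hβ₀1 hr0 ha1 ha2
  have hg_cont : ContinuousOn g (Icc (1 / Λ) (1 / 2)) := by
    intro v hv
    have hv0 : 0 < v := hr0.trans_le hv.1
    simp only [hg]
    refine (continuousAt_const.mul ((ContinuousAt.add (ContinuousAt.add ?_ ?_) ?_))).continuousWithinAt
    · exact (continuousAt_const.mul (Real.continuousAt_rpow_const _ _ (Or.inl hv0.ne'))).div (by fun_prop) (by linarith)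
    · exact (continuousAt_const.mul (Real.continuousAt_rpow_const _ _ (Or.inl hv0.ne'))).div (by fun_prop) (by linarith)
    · exact (continuousAt_const.mul (Real.continuousAt_rpow_const _ _ (Or.inl hv0.ne'))).div (by fun_prop) (by positivity)
  -- boundary values
  have hbd_r : ∀ v : ℝ, |v| = 1 / Λ → ‖h v‖ ≤ 4 * M₀ * Λ ^ (-β₀) / a := by
    intro v hv
    have := (hB v (by rw [hv]; exact hr2)).2.1 (by rw [hv])
    rw [hv, ← hβ₀, ← hM₀, ← ha] at this
    refine this.trans ?_
    rw [Real.div_rpow zero_le_one hΛ0.le, Real.one_rpow, one_div (Λ ^ β₀), ← Real.rpow_neg hΛ0.le]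
    exact div_le_div_of_nonneg_left (by positivity) ha0 (by linarith)
  have hbd_half : ∀ v : ℝ, |v| = 1 / 2 → ‖h v‖ ≤ 8 * M₀ := by
    intro v hv
    have := (hB v (by rw [hv])).2.1 (by rw [hv]; exact hr2)
    rw [hv, ← hβ₀, ← hM₀, ← ha] at this
    refine this.trans ?_
    have h1 : (1 / 2 : ℝ) ^ β₀ ≤ 1 := Real.rpow_le_one (by norm_num) (by norm_num) hβ₀0.le
    rw [div_le_iff₀ (by linarith)]
    nlinarith
  -- right side
  have hR : ‖∫ v in (1 / Λ)..(1 / 2), h v * exp (((Λ * v : ℝ) : ℂ) * I)‖ ≤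
      (4 * M₀ * Λ ^ (-β₀) / a + 8 * M₀ + 4 * M₀ * (a ^ (β₀ - 1) * (3 + 3 / (1 - β₀)) + L₀ / β₀)) / Λ := by
    refine (norm_integral_mul_exp_le hr2 hΛ0 (fun v _ ↦ hderiv v) hcont'.continuousOn).trans ?_
    refine div_le_div_of_nonneg_right (add_le_add (add_le_add (hbd_r _ (abs_of_pos hr0))
      (hbd_half (1 / 2) (abs_of_pos (by norm_num)))) ?_) hΛ0.le
    refine le_trans (intervalIntegral.integral_mono_on hr2 ?_ (hg_cont.intervalIntegrable_of_Icc hr2)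
      fun v hv ↦ ?_) hIg
    · exact (hcont'.norm).intervalIntegrable _ _
    · have hv0 : 0 < v := hr0.trans_le hv.1
      have := (hB v (by rw [abs_of_pos hv0]; exact hv.2)).2.2 (by rw [abs_of_pos hv0]; exact hv.1)
      rw [abs_of_pos hv0, ← hβ₀, ← hM₀, ← ha, ← hL₀] at this
      simpa only [hg] using this
  -- left side
  have hLft : ‖∫ v in (-(1 / 2))..(-(1 / Λ)), h v * exp (((Λ * v : ℝ) : ℂ) * I)‖ ≤
      (8 * M₀ + 4 * M₀ * Λ ^ (-β₀) / a + 4 * M₀ * (a ^ (β₀ - 1) * (3 + 3 / (1 - β₀)) + L₀ / β₀)) / Λ := by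
    have hle : -(1 / 2 : ℝ) ≤ -(1 / Λ) := by linarith
    refine (norm_integral_mul_exp_le hle hΛ0 (fun v _ ↦ hderiv v) hcont'.continuousOn).trans ?_
    refine div_le_div_of_nonneg_right (add_le_add (add_le_add
      (hbd_half _ (by rw [abs_neg, abs_of_pos (by norm_num)]))
      (hbd_r _ (by rw [abs_neg, abs_of_pos hr0]))) ?_) hΛ0.le
    have hcomp : ∫ v in (-(1 / 2))..(-(1 / Λ)), g |v| = ∫ v in (1 / Λ)..(1 / 2), g v := by
      rw [← intervalIntegral.integral_comp_neg]
      refine intervalIntegral.integral_congr fun v hv ↦ ?_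
      rw [uIcc_of_le hr2] at hv
      simp [abs_neg, abs_of_pos (hr0.trans_le hv.1)]
    refine le_trans (intervalIntegral.integral_mono_on hle ?_ ?_ fun v hv ↦ ?_) (hcomp ▸ hIg)
    · exact (hcont'.norm).intervalIntegrable _ _
    · refine ContinuousOn.intervalIntegrable_of_Icc hle ?_
      intro v hv
      have hv0 : v < 0 := by linarith [hv.2]
      have : ContinuousWithinAt (fun v : ℝ ↦ g (-v)) (Icc (-(1 / 2)) (-(1 / Λ))) v := by
        refine ((hg_cont (-v) ⟨by linarith [hv.2], by linarith [hv.1]⟩).comp continuous_neg.continuousWithinAt ?_)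
        intro u hu; exact ⟨by linarith [hu.2], by linarith [hu.1]⟩
      refine this.congr (fun u hu ↦ ?_) ?_
      · simp [abs_of_neg (by linarith [hu.2] : u < 0)]
      · simp [abs_of_neg hv0]
    · have hvneg : v < 0 := by linarith [hv.2]
      have hva : |v| = -v := abs_of_neg hvneg
      have := (hB v (by rw [hva]; linarith [hv.1])).2.2 (by rw [hva]; linarith [hv.2])
      rw [← hβ₀, ← hM₀, ← ha, ← hL₀] at this
      simpa only [hg] using this
  -- window
  have hwin : ‖∫ v in (-(1 / Λ))..(1 / Λ), h v * exp (((Λ * v : ℝ) : ℂ) * I)‖ ≤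
      2 * M₀ * (2 / Λ) ^ β₀ / a * |1 / Λ - -(1 / Λ)| := by
    refine intervalIntegral.norm_integral_le_of_norm_le_const fun v hv ↦ ?_
    rw [uIoc_of_le (by linarith), mem_Ioc] at hv
    rw [norm_mul, norm_exp_ofReal_mul_I, mul_one]
    have hv' : |v| ≤ 1 / Λ := abs_le.2 ⟨hv.1.le, hv.2⟩
    have := (hB v (hv'.trans hr2)).1 hv'
    rwa [← hβ₀, ← hM₀, ← ha] at this
  have hwin' : ‖∫ v in (-(1 / Λ))..(1 / Λ), h v * exp (((Λ * v : ℝ) : ℂ) * I)‖ ≤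
      4 * M₀ * (2 / Λ) ^ β₀ / (Λ * a) := by
    refine hwin.trans (le_of_eq ?_)
    have h2 : |1 / Λ - -(1 / Λ)| = 2 / Λ := by
      rw [show (1 / Λ - -(1 / Λ) : ℝ) = 2 / Λ by ring, abs_of_pos (div_pos two_pos hΛ0)]
    rw [h2]; field_simp; ring
  -- split
  have hint : ∀ a₁ a₂ : ℝ, IntervalIntegrable (fun v ↦ h v * exp (((Λ * v : ℝ) : ℂ) * I)) volume a₁ a₂ :=
    fun a₁ a₂ ↦ (hcont.mul (by fun_prop)).intervalIntegrable _ _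
  have hsplit : (∫ v in (-(1 / 2))..(1 / 2), h v * exp (((Λ * v : ℝ) : ℂ) * I)) =
      (∫ v in (-(1 / 2))..(-(1 / Λ)), h v * exp (((Λ * v : ℝ) : ℂ) * I)) +
      (∫ v in (-(1 / Λ))..(1 / Λ), h v * exp (((Λ * v : ℝ) : ℂ) * I)) +
        ∫ v in (1 / Λ)..(1 / 2), h v * exp (((Λ * v : ℝ) : ℂ) * I) := by
    rw [integral_add_adjacent_intervals (hint _ _) (hint _ _), integral_add_adjacent_intervals (hint _ _) (hint _ _)]
  rw [hsplit]
  refine (norm_add₃_le).trans ?_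
  refine (add_le_add (add_le_add hLft hwin') hR).trans (le_of_eq ?_)
  have hb : Λ ^ (-β₀) = Λ ^ (montgomeryCoeff m 0) := by rw [hβ₀, neg_neg]
  rw [hb]
  ring

/-! ## Summing the pieces `k ∉ {0, 1}` -/

omit h18 h19 in
/-- `Σ_{i ≤ 2K, i ≠ K} 1/|i − K| ≤ 2(1 + log K)`. [folklore] -/
theorem sum_inv_abs_sub_le (K : ℕ) :
    ∑ i ∈ (Finset.range (2 * K + 1)).filter (fun i ↦ i ≠ K), 1 / |(i : ℝ) - K| ≤ 2 * (1 + Real.log K) := by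
  have hsplit : (Finset.range (2 * K + 1)).filter (fun i ↦ i ≠ K) =
      Finset.range K ∪ Finset.Ioc K (2 * K) := by
    ext i; simp only [Finset.mem_filter, Finset.mem_range, Finset.mem_union, Finset.mem_Ioc]; omega
  have hdisj : Disjoint (Finset.range K) (Finset.Ioc K (2 * K)) := by
    rw [Finset.disjoint_left]; intro i hi; simp only [Finset.mem_range] at hi; simp only [Finset.mem_Ioc]; omega
  rw [hsplit, Finset.sum_union hdisj]
  have h1 : ∑ i ∈ Finset.range K, 1 / |(i : ℝ) - K| = ∑ j ∈ Finset.Icc 1 K, 1 / (j : ℝ) := by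
    refine Finset.sum_nbij' (fun i ↦ K - i) (fun j ↦ K - j) ?_ ?_ ?_ ?_ ?_
    · intro i hi; rw [Finset.mem_range] at hi; rw [Finset.mem_Icc]; omega
    · intro j hj; rw [Finset.mem_Icc] at hj; rw [Finset.mem_range]; omega
    · intro i hi; rw [Finset.mem_range] at hi; omega
    · intro j hj; rw [Finset.mem_Icc] at hj; omega
    · intro i hi
      rw [Finset.mem_range] at hi
      rw [Nat.cast_sub hi.le, abs_of_neg (by rw [sub_neg]; exact_mod_cast hi)]
      ring
  have h2 : ∑ i ∈ Finset.Ioc K (2 * K), 1 / |(i : ℝ) - K| = ∑ j ∈ Finset.Icc 1 K, 1 / (j : ℝ) := by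
    refine Finset.sum_nbij' (fun i ↦ i - K) (fun j ↦ j + K) ?_ ?_ ?_ ?_ ?_
    · intro i hi; rw [Finset.mem_Ioc] at hi; rw [Finset.mem_Icc]; omega
    · intro j hj; rw [Finset.mem_Icc] at hj; rw [Finset.mem_Ioc]; omega
    · intro i hi; rw [Finset.mem_Ioc] at hi; omega
    · intro j _; omega
    · intro i hi
      rw [Finset.mem_Ioc] at hi
      rw [Nat.cast_sub hi.1.le, abs_of_pos (by rw [sub_pos]; exact_mod_cast hi.1)]
  rw [h1, h2]
  have hharm : ∑ j ∈ Finset.Icc 1 K, 1 / (j : ℝ) ≤ 1 + Real.log K := by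
    have h := harmonic_le_one_add_log K
    rw [harmonic_eq_sum_Icc, Rat.cast_sum] at h
    refine le_trans (le_of_eq (Finset.sum_congr rfl fun j _ ↦ ?_)) h
    simp
  linarith [hharm]

/-- **The pieces `k ∉ {0,1}` add up to little**: with `M_* = e^{A₁ + A₂ log log(K₀+5)}`,
`L_* = A₃ + A₄ log(K₀+5)` (`A₂, A₃, A₄ ≥ 0`),
`Σ_{|k| ≤ K₀, k ≠ 0, 1} ‖∫ h_k e^{iΛv}‖ ≤ (M_*/Λ)(40Λ^{1/3} + 48L_* + 224) · 2(1 + log K₀)`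
(since `|b̂(k)| ≤ 1/3` for these `k`). [cite: Montgomery1983, §4 (22)] -/
theorem sum_norm_pieces_le (hA₂ : 0 ≤ A₂) (hA₃ : 0 ≤ A₃) (hA₄ : 0 ≤ A₄) {Λ : ℝ} (hΛ : 2 ≤ Λ) {α t : ℝ}
    (ht : |t| ≤ 1 / 4) (c : ℤ → ℂ) (hc : ∀ k, ‖c k‖ ≤ 1) (K₀ : ℕ) :
    ∑ i ∈ (Finset.range (2 * K₀ + 1)).filter (fun i ↦ i ≠ K₀ ∧ i ≠ K₀ + 1),
      ‖∫ v in (-(1 / 2))..(1 / 2), pieceFun m Λ α t (c ((i : ℤ) - K₀)) ((i : ℤ) - K₀) v *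
        exp (((Λ * v : ℝ) : ℂ) * I)‖ ≤
      Real.exp (A₁ + A₂ * Real.log (Real.log ((K₀ : ℝ) + 5))) / Λ *
        (40 * Λ ^ (1 / 3 : ℝ) + 48 * (A₃ + A₄ * Real.log ((K₀ : ℝ) + 5)) + 224) * (2 * (1 + Real.log K₀)) := by
  have hΛ0 : 0 < Λ := by linarith
  set M := Real.exp (A₁ + A₂ * Real.log (Real.log ((K₀ : ℝ) + 5))) with hM
  set L := A₃ + A₄ * Real.log ((K₀ : ℝ) + 5) with hL
  have hL0 : 0 ≤ L := add_nonneg hA₃ (mul_nonneg hA₄ (Real.log_nonneg (by linarith [(Nat.cast_nonneg K₀ : (0:ℝ) ≤ K₀)])))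
  set Q := M / Λ * (40 * Λ ^ (1 / 3 : ℝ) + 48 * L + 224) with hQ
  have hQ0 : 0 ≤ Q := by positivity
  -- termwise
  have hterm : ∀ i ∈ (Finset.range (2 * K₀ + 1)).filter (fun i ↦ i ≠ K₀ ∧ i ≠ K₀ + 1),
      ‖∫ v in (-(1 / 2))..(1 / 2), pieceFun m Λ α t (c ((i : ℤ) - K₀)) ((i : ℤ) - K₀) v *
        exp (((Λ * v : ℝ) : ℂ) * I)‖ ≤ Q * (1 / |(i : ℝ) - K₀|) := by
    intro i hi
    simp only [Finset.mem_filter, Finset.mem_range] at hi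
    set k : ℤ := (i : ℤ) - K₀ with hk
    have hk0 : k ≠ 0 := by omega
    have hk1 : k ≠ 1 := by omega
    have hkK' : |k| ≤ (K₀ : ℤ) := by rw [hk, abs_le]; omega
    have hkK : |(k : ℝ)| ≤ K₀ := by exact_mod_cast hkK'
    have hkR : |(i : ℝ) - K₀| = |(k : ℝ)| := by rw [hk]; push_cast; ring_nf
    refine (norm_piece_le m h18 h19 hA₃ hA₄ hΛ ht (hc k) hk0).trans ?_
    -- monotonicity in `k`
    have hlog : Real.log (|(k : ℝ)| + 5) ≤ Real.log ((K₀ : ℝ) + 5) :=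
      Real.log_le_log (by linarith [abs_nonneg (k : ℝ)]) (by linarith)
    have hMk : Real.exp (A₁ + A₂ * Real.log (Real.log (|(k : ℝ)| + 5))) ≤ M := by
      refine Real.exp_le_exp.2 (add_le_add le_rfl (mul_le_mul_of_nonneg_left ?_ hA₂))
      exact Real.log_le_log (by linarith [one_le_log_abs_add_five (k : ℝ)]) hlog
    have hLk : A₃ + A₄ * Real.log (|(k : ℝ)| + 5) ≤ L := add_le_add le_rfl (mul_le_mul_of_nonneg_left hlog hA₄)
    have hb : max (montgomeryCoeff m k) 0 ≤ 1 / 3 :=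
      max_le ((le_abs_self _).trans (abs_montgomeryCoeff_le_third m hk0 hk1)) (by norm_num)
    have hP : Λ ^ (max (montgomeryCoeff m k) 0) ≤ Λ ^ (1 / 3 : ℝ) :=
      Real.rpow_le_rpow_of_exponent_le (by linarith) hb
    have hkpos : 0 < |(k : ℝ)| := abs_pos.2 (by exact_mod_cast hk0)
    rw [hkR]
    have hLk0 : 0 ≤ A₃ + A₄ * Real.log (|(k : ℝ)| + 5) :=
      add_nonneg hA₃ (mul_nonneg hA₄ ((one_le_log_abs_add_five _).trans' zero_le_one))
    have hP0 : 0 ≤ Λ ^ (max (montgomeryCoeff m k) 0) := Real.rpow_nonneg hΛ0.le _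
    calc Real.exp (A₁ + A₂ * Real.log (Real.log (|(k : ℝ)| + 5))) / (Λ * |(k : ℝ)|) *
          (40 * Λ ^ (max (montgomeryCoeff m k) 0) + 48 * (A₃ + A₄ * Real.log (|(k : ℝ)| + 5)) + 224)
        ≤ M / (Λ * |(k : ℝ)|) * (40 * Λ ^ (1 / 3 : ℝ) + 48 * L + 224) := by
          refine mul_le_mul (div_le_div_of_nonneg_right hMk (by positivity)) (by linarith) (by positivity)
            (by positivity)
      _ = Q * (1 / |(k : ℝ)|) := by simp only [hQ]; field_simp
  refine (Finset.sum_le_sum hterm).trans ?_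
  rw [← Finset.mul_sum]
  refine mul_le_mul_of_nonneg_left ?_ hQ0
  calc ∑ i ∈ (Finset.range (2 * K₀ + 1)).filter (fun i ↦ i ≠ K₀ ∧ i ≠ K₀ + 1), 1 / |(i : ℝ) - K₀|
      ≤ ∑ i ∈ (Finset.range (2 * K₀ + 1)).filter (fun i ↦ i ≠ K₀), 1 / |(i : ℝ) - K₀| := by
        refine Finset.sum_le_sum_of_subset_of_nonneg (fun i hi ↦ ?_) fun i _ _ ↦ by positivity
        simp only [Finset.mem_filter] at hi ⊢
        exact ⟨hi.1, hi.2.1⟩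
    _ ≤ 2 * (1 + Real.log K₀) := sum_inv_abs_sub_le K₀

end PieceBounds

/-! ## The Perron integral along `Re(s+w) = 1 + 1/log x` as a sum of pieces -/

/-- `(x : ℂ)^w = exp(w log x)` for real `x > 0`. [folklore] -/
theorem ofReal_cpow_eq_exp {x : ℝ} (hx : 0 < x) (w : ℂ) : (x : ℂ) ^ w = exp ((Real.log x : ℂ) * w) := by
  rw [cpow_def_of_ne_zero (ofReal_ne_zero.2 hx.ne'), ofReal_log hx.le]

/-- **The integral of (20) split into unit pieces**: with `Λ = log x ≥ 2`, `Re s + α = 1 + 1/Λ`, `α ≠ 0`,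
`t = Im s` and `T₁ = K₀ + 1/2 − t`, `T₂ = K₀ + 1/2 + t`,
`∫_{-T₂}^{T₁} f(s+α+iu) x^{α+iu}/(α+iu) du = x^α Σ_{k=-K₀}^{K₀} ∫_{-1/2}^{1/2} h_k(v) e^{iΛv} dv`
(`u = k + v − t`, `h_k` = `pieceFun` with the unimodular constant `c_k = x^{i(k−t)}`). [cite: Montgomery1983, §4 (20)–(21)] -/
theorem perron_integral_eq_sum_pieces {x : ℝ} (hx1 : 1 < x) (hx : 2 ≤ Real.log x) {s : ℂ} {α : ℝ}
    (hσ : s.re + α = 1 + 1 / Real.log x) (hα : α ≠ 0) (K₀ : ℕ) :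
    ∫ u in (-((K₀ : ℝ) + 1 / 2 + s.im))..((K₀ : ℝ) + 1 / 2 - s.im),
        montgomeryF m (s + α + u * I) * ((x : ℂ) ^ ((α : ℂ) + u * I) / ((α : ℂ) + u * I)) =
      (x : ℂ) ^ (α : ℂ) * ∑ i ∈ Finset.range (2 * K₀ + 1),
        ∫ v in (-(1 / 2))..(1 / 2), pieceFun m (Real.log x) α s.im
          ((x : ℂ) ^ (((((i : ℤ) - K₀ : ℤ) : ℝ) - s.im : ℝ) * I)) ((i : ℤ) - K₀) v *
            exp (((Real.log x * v : ℝ) : ℂ) * I) := by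
  set Λ := Real.log x with hΛ
  have hΛ0 : 0 < Λ := by linarith
  have hx0 : 0 < x := by linarith
  have hxc : (x : ℂ) ≠ 0 := ofReal_ne_zero.2 hx0.ne'
  set t := s.im with ht
  set σ := s.re with hσ'
  -- the integrand
  set G : ℝ → ℂ := fun u ↦ montgomeryF m (s + α + u * I) * ((x : ℂ) ^ ((α : ℂ) + u * I) / ((α : ℂ) + u * I))
    with hG
  have hre : ∀ u : ℝ, (s + α + u * I).re = 1 + 1 / Λ := fun u ↦ by simp [← hσ', hσ]
  have hden : ∀ u : ℝ, (α : ℂ) + u * I ≠ 0 := fun u h ↦ by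
    have := congrArg Complex.re h; simp at this; exact hα this
  have hGc : Continuous G := by
    have h1 : Continuous fun u : ℝ ↦ montgomeryF m (s + α + u * I) := by
      refine continuous_iff_continuousAt.2 fun u ↦ ?_
      have hd := differentiableAt_montgomeryF m (z := s + α + u * I) (by rw [hre]; linarith [one_div_pos.2 hΛ0])
        (by rw [hre]; have : 1 / Λ ≤ 1 / 2 := one_div_le_one_div_of_le (by norm_num) hx; linarith)
      exact hd.continuousAt.comp (f := fun u : ℝ ↦ s + α + u * I) (by fun_prop)
    have h2 : Continuous fun u : ℝ ↦ (x : ℂ) ^ ((α : ℂ) + u * I) := by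
      simp_rw [ofReal_cpow_eq_exp hx0]; fun_prop
    simp only [hG]
    exact h1.mul (h2.div (by fun_prop) hden)
  -- Step 1: `u = y - t`
  have h1 : ∫ u in (-((K₀ : ℝ) + 1 / 2 + t))..((K₀ : ℝ) + 1 / 2 - t), G u =
      ∫ y in (-(K₀ : ℝ) - 1 / 2)..((K₀ : ℝ) + 1 / 2), G (y - t) := by
    rw [intervalIntegral.integral_comp_sub_right G t]
    congr 1; ring
  -- Step 2: unit pieces
  set a : ℕ → ℝ := fun i ↦ (-(K₀ : ℝ) - 1 / 2) + i with ha
  have hadj := intervalIntegral.sum_integral_adjacent_intervals (f := fun y ↦ G (y - t)) (a := a) (μ := volume)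
    (n := 2 * K₀ + 1) (fun i _ ↦ (hGc.comp (continuous_sub_right t)).intervalIntegrable (a i) (a (i + 1)))
  have ha0 : a 0 = -(K₀ : ℝ) - 1 / 2 := by simp [ha]
  have han : a (2 * K₀ + 1) = (K₀ : ℝ) + 1 / 2 := by simp only [ha]; push_cast; ring
  rw [ha0, han] at hadj
  -- Step 3/4: each piece
  have hpiece : ∀ i ∈ Finset.range (2 * K₀ + 1), ∫ y in (a i)..(a (i + 1)), G (y - t) =
      (x : ℂ) ^ (α : ℂ) * ∫ v in (-(1 / 2))..(1 / 2), pieceFun m Λ α t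
        ((x : ℂ) ^ (((((i : ℤ) - K₀ : ℤ) : ℝ) - t : ℝ) * I)) ((i : ℤ) - K₀) v * exp (((Λ * v : ℝ) : ℂ) * I) := by
    intro i _
    set k : ℤ := (i : ℤ) - K₀ with hk
    have hkR : (k : ℝ) = (i : ℝ) - K₀ := by rw [hk]; push_cast; ring
    have hai : a i = -(1 / 2) + (k : ℝ) := by simp only [ha, hkR]; ring
    have hai1 : a (i + 1) = 1 / 2 + (k : ℝ) := by simp only [ha, hkR]; push_cast; ring
    rw [hai, hai1, ← intervalIntegral.integral_comp_add_right (fun y ↦ G (y - t)) (k : ℝ),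
      ← intervalIntegral.integral_const_mul]
    refine intervalIntegral.integral_congr fun v _ ↦ ?_
    -- pointwise identity
    have hz : s + α + (((v + k - t : ℝ)) : ℂ) * I = zline Λ (k + v) := by
      apply Complex.ext
      · simp [zline, ← hσ', hσ]
      · simp [zline, ← ht]; ring
    have hcpow : (x : ℂ) ^ ((α : ℂ) + ((v + k - t : ℝ) : ℂ) * I) =
        (x : ℂ) ^ (α : ℂ) * ((x : ℂ) ^ ((((k : ℝ) - t : ℝ) : ℂ) * I) * exp (((Λ * v : ℝ) : ℂ) * I)) := by
      rw [ofReal_cpow_eq_exp hx0, ofReal_cpow_eq_exp hx0, ofReal_cpow_eq_exp hx0, ← exp_add, ← exp_add]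
      congr 1
      push_cast
      ring
    simp only [hG]
    rw [show ((v + (k : ℝ) - t : ℝ) : ℂ) = ((v + k - t : ℝ) : ℂ) by push_cast; ring] at *
    rw [show s + ↑α + ↑(v + ↑k - t) * I = zline Λ (k + v) from hz, hcpow, pieceFun]
    have hd : (α : ℂ) + ((v + k - t : ℝ) : ℂ) * I = (α : ℂ) + (((k : ℝ) + v - t : ℝ) : ℂ) * I := by
      push_cast; ring
    rw [hd]
    field_simp
  calc ∫ u in (-((K₀ : ℝ) + 1 / 2 + t))..((K₀ : ℝ) + 1 / 2 - t), G u
      = ∫ y in (-(K₀ : ℝ) - 1 / 2)..((K₀ : ℝ) + 1 / 2), G (y - t) := h1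
    _ = ∑ i ∈ Finset.range (2 * K₀ + 1), ∫ y in (a i)..(a (i + 1)), G (y - t) := hadj.symm
    _ = _ := by rw [Finset.sum_congr rfl hpiece, ← Finset.mul_sum]

end Line

end Literature.Barriers.RiemannHypothesis

end
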